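import Literature.Barriers.QuantumAdvantage.RelativizationProofs
import Literature.Barriers.QuantumAdvantage.AlgebrizationProofs
import Literature.Barriers.QuantumAdvantage.AlgebrizationSymmetric
import Literature.Barriers.QuantumAdvantage.SeparationPrerequisitesProofs
import Literature.Barriers.QuantumAdvantage.NaturalProofsProofs
import Literature.Barriers.QuantumAdvantage.RandomOracleMethodHolds
import Literature.Barriers.QuantumAdvantage.SupremacyTheoremsNonRelativizingHolds
import Literature.Barriers.QuantumAdvantage.PPolyOraclesDischarge
import Literature.Barriers.QuantumAdvantage.PromiseLiftRelativization
import Literature.Barriers.QuantumAdvantage.TotalFunctionSpeedupLimitProofs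
import Literature.Barriers.QuantumAdvantage.BoundedEntanglementHolds
import Literature.Barriers.QuantumAdvantage.TensorNetworkContractionCor15
import Literature.Barriers.QuantumAdvantage.TensorNetworkContractionProofs
import Literature.Barriers.QuantumAdvantage.TensorNetworkContractionEngineFP
import Literature.Barriers.QuantumAdvantage.LatticeRigidityProofs
import Literature.Barriers.QuantumAdvantage.UncorrectedNoiseProofs
import Literature.Barriers.QuantumAdvantage.NoiseThresholdUpperBoundsProofs
import Literature.Barriers.QuantumAdvantage.LinearXEBSpoofing
import Literature.Barriers.QuantumAdvantage.QuantumNaturalProofs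
import HarnessLib

/-!
# Barrier catalogue of the summit `QuantumAdvantage` (the tree copy of `Summits/QuantumAdvantage/BARRIERS.md`)

Topic `Literature/Barriers/QuantumAdvantage` (D-0021). This module is the IN-TREE CARRIER of the summit's barrier
catalogue `BARRIERS.md` (mode `barrier-catalogue`; generation 1: unit `barriers-QuantumAdvantage-l1`, 2026-08-16;
generation 2: unit `barriers-QuantumAdvantage-l1-g2`, 2026-08-17): the gate has no markdown / summit-document target
class (`Summits/<S>/BARRIERS.md|.lean` are outside the target regex, there is no `kit propose`, and `ledger crux write`
reaches only `Cruxes/<CruxDecl>/`), so the markdown is carried VERBATIM as this module docstring, next to the entries it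
catalogues, and the module adds ONE checked declaration, `catalogue_partA_established` — the conjunction of every Part-A
barrier fact that is dischargeable inside `Literature`, proved by the existing `*_holds` theorems (a machine-checked
reading of the catalogue's status column; nothing new is asserted). Generation 2 extends the conjunction by the three
facts discharged since generation 1: `QuantumNaturalProofs` (entry A19), `NaturalProofsNarrow` (A04 audit) and
`BQPRelativizationNarrow` (A01 audit). The canonical markdown lives in the cataloguer's folder
(`run/sessions/planner-barriers-QuantumAdvantage-l1-g2-0/folder/BARRIERS.md`); the payload path
`lean/Summits/QuantumAdvantage/BARRIERS.md` needs an operator copy. Refresh policy: re-armed daily; a refresh REPLACES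
the docstring below and extends the conjunction when new entries are discharged.

-----------------------------------------------------------------------------------------------------------------------------------

# QuantumAdvantage — barrier catalogue (`BARRIERS.md`)

Summit: `QuantumAdvantage := Literature.QuantumAdvantage.BQPNotSubsetBPP := ∃ L : Language Bool, L ∈ BQP ∧ L ∉ BPP`
(`Summits/QuantumAdvantage/QuantumAdvantage/Statement.lean`; single-conjunct summit, Sub = `QuantumAdvantage`;
`BQP` = poly-time-uniform oracle-free Clifford+T families, error ≤ 1/3, wire 0; `BPP = bp P`).

Generation 2 · compiled 2026-08-17 by `planner-barriers-QuantumAdvantage-l1-g2-0` (mode `barrier-catalogue`, unit `barriers-QuantumAdvantage-l1-g2`;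
generation 1: 2026-08-16, `planner-barriers-QuantumAdvantage-l1-0`) · re-armed daily; gen-2 deltas are marked `[g2]`. Sources scanned, exhaustively:
`lean/Literature/Barriers/QuantumAdvantage/*.lean` (185 files = 18 D-0021 entries + 2 tombstones + proof programmes + the gen-1 carrier `Catalogue.lean`;
new since gen 1: `QuantumNaturalProofs.lean`, `CryptoOWFCollapseWorld.lean`, `NaturalProofsScope.lean`, `SupremacyTheoremsNonRelativizingFixedProblem.lean`,
`PPolyOraclesThm76Frontier.lean`, and the 2026-08-16 barrier-audit addenda inside `Relativization`, `Algebrization`/`AlgebrizationSymmetric`, `SeparationPrerequisites`,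
`NaturalProofs`, `TotalFunctionSpeedupLimit`, `NoiseThresholdUpperBounds`), `lean/Summits/QuantumAdvantage/QuantumAdvantage/Theorems/*Refutation.lean` (6; new:
`RegulatorThirdThirdNotBPPRefutation.lean`), `…/Theorems/<Crux>/Negative/*.lean` (27 directories, 105 files; new directories `CompactnessPrinciple`, `LanguageLadder`,
new files in `NearExactIsExact`), `ledger negatives --problem QuantumAdvantage` (6 items), items and headers of all 56 `Theses/*.lean` (`ledger route list` +
`ledger workitem get route-…`: 39 open, 3 draft in the D-0033 tribunal — CubicForrelation, WhiteBoxWalk, HankelLift —, AreaUncertainty `done`, 13 closed),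
the 28 standing-disprover work files `Cruxes/<Crux>/Disproof.lean` (new: CompactnessPrinciple, LanguageLadder), and the stub-level refutation / strength files
landed flat under `Theorems/` since gen 1 (MobiusLadder, ArithStatLadder and CompactnessLift lines; D28, C13–C15).
NOT available on this hub: `run/shared/priority/refutations.json` (payload `negatives_index`; the directory does not exist) — the ledger negatives index was
used instead and agrees with the six `*Refutation.lean` files.
In-tree carrier of this file: `Literature/Barriers/QuantumAdvantage/Catalogue.lean` (module docstring = this markdown verbatim; theorem
`Literature.Barriers.QuantumAdvantage.catalogue_partA_established` = the conjunction of the discharged Part-A facts; gen 2 extends it by `QuantumNaturalProofs`,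
`NaturalProofsNarrow` and `BQPRelativizationNarrow`). The gate STILL has no markdown / summit-document target class: `ledger propose --target
Summits/QuantumAdvantage/BARRIERS.md|.lean` is refused by the target regex (only `Summits/<P>/Statement.lean` and `Summits/<P>/<Sub>/{Statement,Theorems/…}.lean`),
there is no `kit propose` verb, and `ledger crux write` reaches only `Cruxes/<CruxDecl>/…`; the payload path `lean/Summits/QuantumAdvantage/BARRIERS.md` therefore
needs an operator copy of this docstring (flagged in the cataloguer's DONE line; markdown copy in the seat folder `BARRIERS.md`).

**How to use (D-0021 / CONVENTIONS §7).** `ledger route open` and `ledger idea add` must address, by decl name, every entry of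
Part A whose technique class matches theirs (`- Literature.Barriers.QuantumAdvantage.<Name>: <evasion | it does not; the bet is …>`),
and should treat Parts B–D as the negatives index: a thesis, crux or stub that restates a refuted statement (Part B), a refuted
strengthening / dropped-hypothesis variant (Part D), or a retired mechanism (Part C) is dead on arrival. Every entry below gives:
the exact statement (Lean, abridged only where marked) + decl + file; status (THEOREM = discharged in the tree / NAMED FACT / REFUTED /
OPEN); the class of routes or arguments it kills; the escaping hypothesis if any; and — the cataloguer's reading, advisory — the
currently open routes/cruxes it threatens (route names = `route-QuantumAdvantage-<Name>`, items = `stmt-QuantumAdvantage-<n>`, written `stmt-<n>`).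

Entry ids are stable: `QA-A..` Literature barriers, `QA-B..` refuted route statements, `QA-C..` proved kills / dequantizations /
retired mechanisms, `QA-D..` crux-level negative lemmas, `QA-E..` cross-cutting failure patterns. **78 entries** (A 20 · B 6 · C 15 · D 28 · E 9; gen 1 had 68).

---------------------------------------------------------------------------------------------------------------------------------

## Index

| id | decl / object | status | technique class (keywords) | threatens (open) |
|---|---|---|---|---|
| A01 | `Relativization` (+ `BQPRelativizationNarrow` [g2]) | THEOREM | relativizing, black-box, diagonalization; [g2] exact reach: thin (tally/sparse/`P/poly`) oracles carry no barrier against the summit unless `BQP ⊆ P/poly` | all unconditional routes, both sides |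
| A02 | `Algebrization` | THEOREM | arithmetization, low-degree extension, sum-check-style interactive proofs (not PCP); separation direction also k-fold + symmetric | same |
| A03 | `SeparationPrerequisites` (+ `sharp_of_facts` [g2]) | THEOREM | unconditional separation ⇒ `AWPP ⊄ BPP` [g2], `PP ⊄ BPP`, `P ≠ PSPACE` | every positive-side route |
| A04 | `NaturalProofs` (+ `NaturalProofsNarrow` [g2]) | THEOREM (conditional content) | Γ-natural properties (Γ ∈ {`P`,`BPP`}) vs `P/poly` lower bounds; [g2] the quantum door `quantumNatural_dichotomy` | `IqThreeNotPPoly`, `LiouvilleNotPPoly`, `YbDiagTT…`, any `∉ P/poly` crux |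
| A05 | `RandomOracleMethod` | THEOREM | random-oracle collapses/separations | RandomOracleGauge, SosSandwich, SpikesNeedAddresses, Refuters |
| A06 | `SupremacyTheoremsNonRelativizing` (+ fixed-problem templates [g2]) | THEOREM | PH-collapse templates (also per fixed `D ∈ SampBQP` [g2]), OWF ⇒ separation, approximate sampling | ParityFrontier, Refuters, WhiteBoxWalk, GenericInertness, CommutingDeciders |
| A07 | `PPolyOracles` (+ `PPolyOracleSeparation` OPEN) | THEOREM (Thm 7.6 unconditional via HILL; Thm 8.1 conjunct vacuous, flagged) | efficiently computable oracles | WhiteBoxWalk, Refuters, PadKuperberg, CodeCarries |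
| A08 | `PromiseLiftRelativization` | THEOREM (new, in-tree) | promise→language lift | `PlLift` stmt-0250 (7 routes), `PlPromiseIsLift`, `PromiseTransfer`, `OpiLiftPromise`, `UniformExponentLift` 18126 [g2] |
| A09 | `TotalFunctionSpeedupLimit` | THEOREM | query complexity of TOTAL DECISION functions ([g2] narrowed; relations escape: `yamakawaZhandry2022_totalSearch`) | black-box engines: WhiteBoxWalk, HiddenSpread, SosSandwich/SpikesNeedAddresses (AA side) |
| A10 | `jozsaLinden2003_pblocked` (BoundedEntanglement) | THEOREM | bounded multipartite entanglement | witness families of positive routes; YangBaxterIslands, CommutingDeciders |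
| A11 | `markovShi2008_cor15/_anyOrder/prop51/thm46` (TensorNetworkContraction) | THEOREM | low treewidth / log-depth local circuits | same; shallow/local witness families |
| A12 | `latticeRigidity_finiteImage` (LatticeRigidity) | THEOREM | homomorphic "linear shadow" simulators | ¬side: any compressed group-homomorphic simulator of Toffoli+H |
| A13 | `bremnerMontanaroShepherd2017_thm4` (UncorrectedNoise) | THEOREM | NISQ sampling, noise-agnostic hardness proofs | experimental-proxy arguments; CommutingDeciders (IQP) if noise enters |
| A14 | `NoiseThresholdUpperBounds` (+ `NoiseThresholdUpperBoundsNarrow` [g2]) | THEOREM (narrowed; the `ε₁ = 0` reading REFUTED [g2]) | fault tolerance above threshold, noise on EVERY wire | same |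
| A15 | `linearXEB_not_certifying` (LinearXEBSpoofing) | THEOREM | XEB-certified RCS as evidence | evidence claims only |
| A16 | `noFreeFrame` + 5 (NoFreeFrame family) | THEOREM (Summits-side proofs) | free Clifford / matchgate frames, peaked Pauli spectra | ¬side: PauliFlat, XorDarkCharacters, RectangleFree, ShorLocallyDark, Dequantize-type roads |
| A17 | `SampPRel_empty` | REFUTED tombstone | model bridge `SampP^∅ = SampP` | anyone typing sampling classes |
| A18 | `DegreeOnePrimesEscapeWithoutProper` | REFUTED tombstone | crux with `M ≠ ⊤` dropped | LinnikCubicClassGroups, ThirdFactorialPincer |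
| A19 | `QuantumNaturalProofs` [g2] | THEOREM (content conditional on QHG) | quantum natural proofs: `BQP`-natural properties vs `P/poly`; closes A04's quantum door | every `∉ P/poly` apex (2422, 1389, …) incl. "quantumly checkable" properties |
| A20 | `CryptoOWFCollapseWorld` [g2] | OPEN QUESTION (typed; conditional no-go) | cryptographic OWF ⇒ `BPP ≠ BQP`, argued relativizingly (Fortnow–Rogers §4.1) | WhiteBoxWalk, HiddenSpread, PadKuperberg, CodeCarries, Refuters |
| B01 | `CubicForrelation.CubicStability` stmt-2202 | REFUTED (substantive) | 3/5–1/4 stability for cubic Forrelation | CubicForrelation (repaired as `NearExactIsExact`) |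
| B02 | `SpinorFlattening.GaussRankPolyThesis` stmt-1244 | REFUTED (substantive, designed kill) | Gaussian-rank dequantization | every Gaussian/matchgate-rank road |
| B03 | `KummerSector.KsNotFrobenian` stmt-1615 | REFUTED (misstated) | zero polynomial in Frobenian datum | KummerSector (repaired `KsNotFrobenianR`) |
| B04 | `SeparableFrames.TwoQubitFrameExactness` stmt-9863 | REFUTED (substantive) | κ₂ = 1 frame exactness | one-clean-qubit / separable-frame witnesses |
| B05 | `ShorLocallyDark.MixedMarginalsDark` stmt-8592 | REFUTED (misstated) | even semiprimes | ShorLocallyDark (repaired `MixedMarginalsDarkR`) |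
| B06 | `RegulatorThird.ThirdNotBPP` stmt-15712 [g2] | REFUTED (misstated) | `z = 0` admitted in the cube-class witness clause | RegulatorThird (repaired `ThirdNotBPPR` 15981) |
| C01–C15 | proved kills, dequantizations, retired mechanisms; [g2] C13 padding collapse (`CompactnessPrinciple` void, `LanguageLadder` = summit), C14 apex strengths, C15 conjecture obligations | mixed | see Part C | ¬side roads; cubic Forrelation ladder; white-box walk |
| D01–D28 | crux negative lemmas (27 crux directories + [g2] D28 stub-level refutations) | mixed | load-bearing / tightness / refuted strengthenings | the named cruxes and their lines |
| E01–E09 | failure patterns ([g2] E09: operator classes with free padding carry no exponent) | — | typing traps | every new crux |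

---------------------------------------------------------------------------------------------------------------------------------

## Part A — Catalogued Literature barriers (`Literature/Barriers/QuantumAdvantage/`, namespace `Literature.Barriers.QuantumAdvantage`)

All seventeen head facts (A01–A16, A19) are DISCHARGED in the tree; A20 is an open question typed with its conditional consequences (a `*_holds` theorem exists; the `def X : Prop` stays a def by D-0014). Each carries the
D-0021 block (`technique_class / blocks / because / evasions_known / scope_caveats / status`) in its docstring or module docstring; the
summaries below quote it. "Kills" = the `blocks:` field; "Escape" = `evasions_known:`.

### QA-A01 · Relativization — `Relativization` · THEOREM (`Relativization_holds`, RelativizationProofs.lean)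
- File: `Relativization.lean`. Statement: `∃ A B : Language Bool, BQPRel A ⊆ BPPRel (Oracle.ofLanguage A) ∧ ¬ BQPRel B ⊆ BPPRel (Oracle.ofLanguage B)`
  (packaging of the tree theorem `Literature.Computability.QuantumComplexity.bqp_bpp_relativization_barrier`; oracle facts
  `exists_oracle_BQPRel_subset_BPPRel` [PSPACE-complete oracle, folklore] and `exists_oracle_BQPRel_not_subset_BPPRel` [recursive Fourier
  sampling, Bernstein–Vazirani 1997 Thm 8.10 / Cor 8.14; acceptance target quantum-advantage.S13]).
- Technique class: relativizing, oracle-independent, diagonalization, black-box simulation.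
- Kills: every relativizing proof of the summit (`O ↦ ∃ L ∈ BQP^O, L ∉ BPP^O` at `O = ∅`, `summit_shape_empty_iff`) AND every relativizing
  proof of its negation `BQP ⊆ BPP` (route decl `DeqThesis`/`FFThesis`/`PPThesis`/… stmt-0242): proved no-gos
  `Relativization.not_relativizes_summit_shape`, `Relativization.not_relativizes_collapse_shape`, `Relativization.not_relativizes_either`,
  `Relativization.summary_bqpRelOf` (hypothesis-free for the canonical presentation `bqpRelOf`).
- Escape: non-relativizing ingredients (but arithmetization-type ingredients algebrize and are ALSO insufficient, A02); conditional
  separations (Shor-type bridges) and restricted-model separations are untouched; a simulator that reads the uniform DESCRIPTION of the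
  circuit family (white-box) is non-relativizing by construction — say which step uses the gate list.
- Scope: language classes `BQP^O`, `BPP^O` with XOR-query gates to LANGUAGE oracles only; promise / sampling / `P/poly` / average-case
  strengthenings are not covered here (see A06–A09); equality shapes not derived.
- Threatens: every unconditional route. Positive side: ArithStatLadder (`IqThreeNotBPP` 14864, `IqThreeNotPPoly` 2422), MobiusLadder
  (`LiouvilleNotPPoly` 1389), TwoSquaresLadder (`TwoSquaresNotBPP` 16057), RegulatorThird (`ThirdNotBPPR` 15981; `ThirdNotBPP` 15712 refuted-misstated, B06), CentralFactorial
  (`WilsonThesis` 10304), CommutingDeciders (`CommutingWitness` 2639, `WeightCharacterSignHard` 2642), BochnerSampling/AreaUncertainty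
  (`GraphHSPHard` 2621), DyadicGap (`Target` 1840), YangBaxterIslands (`YbHardness` 2548), ParityFrontier (`Target` 1952), MeasureZeroOne,
  CompactnessLift, Refuters, GenericInertness (`GenSep` 1823 is ABOUT generics — its bridge `LangInertness` 10361 is the non-relativizing
  content and must be argued as such), HiddenSpread, ExponentLadder, WhiteBoxWalk, CodeCarries (`OpiHard` 0995), PromiseLift (`PlThesis`
  0248), PadKuperberg (`TorsorHard` 0927), LinnikCubicClassGroups/DarkClassGroups/ThirdFactorialPincer (hypothesis-type hardness targets).
  Negative side: every stmt-0242 route (Dequantize, ModularRank, PauliFlat, TwoAdicStationaryPhase, ShorLocallyDark, XorDarkCharacters,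
  RectangleFree) and PathInvolution, NeedleThreshold, AmplitudeProofs.
- [g2] New routes since gen 1, same reading: WeilTwice (`JacThreeMemBQP` 16537 is membership — fine; `PriorBand` 16536 / `BeyondMajority` 16538 are
  arithmetic-statistics / restricted-model statements), SelmerBand (`PriorBand` 17066, `SelmerMemBQP` 17067, `BeyondConstant` 17068), StickelbergerGrid
  (`SectorHardness` 17350 hypothesis-type, `GaussPowerFBQP` 17348, `SectorMembershipOfGrid` 17349), HankelLift (`HankelDiscrepancy` 18439, `BeyondRectangles` 18440 —
  rungs below the uniform summit), CompactnessLift re-typed (`UniformExponentLift` 18126, `LanguageLadderR` 18127: both must be argued non-relativizingly or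
  shown to hold in the A08 world; the items' why-might-fail lines say so).
- [g2] Audit 2026-08-16 (`Relativization.lean` §"which oracles carry the barrier"; bounded relativization `CRelativizes 𝒞 Φ` from
  `Literature.Barriers.PneNP.BoundedRelativization`). EXACT REACH: over a class `𝒞` of oracles the summit shape fails to be `𝒞`-relativizing iff `𝒞` contains
  a COLLAPSING world `BQP^A ⊆ BPP^A` (`not_cRelativizes_summit_shape_iff`; `𝒞 = {0}`: `cRelativizes_singleton_zero_summit_shape_iff`), the collapse shape iff
  `𝒞` contains a SEPARATING world (`not_cRelativizes_collapse_shape_iff`). A collapsing world puts `BQP ⊆ BPP^A ⊆ BPP^𝒞`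
  (`BQP_subset_BPPRelClass_of_not_cRelativizes`) and `BQP ⊆ P/poly` when `A ∈ P/poly` (`BQP_subset_PPoly_of_PPoly_collapse`, `…_of_sparse_collapse`,
  `…_of_tally_collapse`, `BQP_subset_PPoly_of_not_cRelativizes_PPoly`), so THIN (tally / sparse / `P/poly`) oracle classes carry NO barrier against the summit
  unless `BQP ⊆ P/poly` (`ppoly_cRelativizes_summit_shape`, `sparse_…`, `tally_…`, for any presentation `PresentsBQPRel C`); on the negation side the whole
  Fortnow–Rogers brain cone `{K ⊕ G : G thin}` collapses (`exists_brain_collapse`, `exists_brain_cone`) and a tally separating world IS the summit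
  (`not_cRelativizes_tally_collapse_shape_of_summit`). Packaged as `BQPRelativizationNarrow` (`BQPRelativizationNarrow_holds`;
  `bqpRelativizationNarrow_iff : BQPRelativizationNarrow ↔ Relativization`; `.of_facts`, `.exists_collapse_PRel`, `.summary`, `.summary'`). Reading for
  planners: a positive-side argument that relativizes only w.r.t. sparse/tally/`P/poly` oracles is NOT caught by A01 — say so explicitly (the refuter will
  ask where `BQP ⊄ P/poly` is avoided); scope line (f): relativizing ≠ black-box (a white-box simulator reading the gate list is non-relativizing by
  construction, but must say which step reads it).

### QA-A02 · Algebrization — `Algebrization` · THEOREM (`Algebrization_holds`, AlgebrizationProofs.lean)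
- File: `Algebrization.lean`. Statement: `aaronsonWigderson2009_bqp_subset_bpp_collapse ∧ aaronsonWigderson2009_bqp_not_subset_bpp`
  (tree facts, `Literature.Computability.Complexity`; unfolded by `algebrization_iff`: `∃ A Ã, Ã.IsExtensionOf A 1 ∧ BQPRel (bitLanguage Ã) ⊆ BPPRel (ofLanguage A)` and `∃ A Ã, … ∧ ¬ BQPRel A ⊆ BPPRel Ã`). Source: Aaronson–Wigderson 2008/09, Thm 5.11(v), Thm 5.2.
- Technique class: algebrizing, arithmetization, low-degree extension, interactive proofs of the sum-check style ONLY (LFKN–Shamir, BFL, GMW as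
  algebrized in AW §3, §8) — not PCPs / local checkability (barrier audit 2026-08-16).
- Kills: algebrizing proofs of `BQP ⊄ BPP` (`Algebrization.not_isAlgebrizingSeparation_bqp_bpp`, `…_bit`) AND of `BQP ⊆ BPP`
  (`Algebrization.not_isAlgebrizingInclusion_bqp_bpp`); "Proving `BPP = BQP` will require non-algebrizing techniques". For the separation
  direction also every `k`-algebrizing proof (AW Thm 10.2's argument) and every proof relativizing w.r.t. extension oracles given to BOTH sides
  (`Algebrization.not_forall_symmetric_separation'`, companion `AlgebrizationSymmetric.lean`, proved); for the inclusion direction the symmetric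
  no-go is proved modulo `BQP^A ⊆ BQP^{bit Ã}` (`Algebrization.not_forall_symmetric_inclusion_of_mono`).
- Escape: (i) for the INCLUSION direction only: iterated ("double") arithmetization — no `A` with `BQP^A ⊄ BPP^{Ã̃}` is known (AW §10.1 p. 43,
  §11(1) p. 46; open in print, AB18/IKK09 do not treat the quantum items); (ii) PCPs / local checkability are outside every algebrization-type
  barrier (AW p. 29 Drucker, §9 p. 42; AB18 §1; IKK09 `ACT ⊊ LCT`); conditional and restricted-model separations untouched.
- Scope: AW notion (inclusions/separations, asymmetric, not closed under inference; an inclusion and the opposite separation can both "algebrize"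
  for an artificial presentation, `exists_isAlgebrizingInclusion_and_isAlgebrizingSeparation`); `ExtensionOracle` over prime fields (affine
  relativization's oracles are `GF(2^k)`-extensions — disjoint field family); quantum access to `Ã` through `Oracle.bitLanguage`; the tree's
  proof of Thm 5.11(v) is XOR-lifted Forrelation + Fourier growth (Girish–Raz–Tal / Raz–Tal), not AW's Raz-1999 sketch (which needs
  query-efficient quantum players).
- Threatens: as A01 — any route whose only non-relativizing ingredient is arithmetization/sum-check/low-degree extension (e.g. a
  `P^{#P}`-style interpolation of acceptance amplitudes) has not escaped.

### QA-A03 · Separation prerequisites — `SeparationPrerequisites` · THEOREM (`SeparationPrerequisites_holds`)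
- File: `SeparationPrerequisites.lean`. Statement: `(∃ L, L ∈ BQP ∧ L ∉ BPP) → ¬ PP ⊆ BPP ∧ P ≠ PP ∧ P ≠ PSharpP ∧ P ≠ PSPACE`
  (from `BQP_subset_PP` Adleman–DeMarrais–Huang, `PP_subset_PSharpP`, `PP_subset_PSPACE`, `P_subset_BPP_holds`). Source: Bernstein–Vazirani 1997 §1 p. 1414.
- Technique class: unconditional class separation; any argument not strong enough to separate `P` from `PP`/`PSPACE`.
- Kills: every unconditional proof of the summit that is not simultaneously a proof of `PP ⊄ BPP`, `P ≠ PP`, `P ≠ P^{#P}`, `P ≠ PSPACE`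
  (`not_PP_subset_BPP_of_witness`, `P_ne_PP_of_witness`, `P_ne_PSharpP_of_witness`, `P_ne_PSPACE_of_witness`; contrapositive
  `not_summit_of_P_eq_PSPACE`). The same floor applies to stronger theses (average-case, `BQP ⊄ P/poly`, promise separations: see D20
  `terminalHard_imp_P_ne_PP`, D15 `PSPACE_not_subset_PPoly_of`, D02 `avgFace_imp_not_mem_BPP`).
- Escape: CONDITIONAL bridges (`FACT ∉ BPP`, `DLOG`, GRH-free class-group hardness, `vanDamSeroussi2002`, ERH, AA conjecture, …) —
  the form every currently credible positive route takes; relativized and restricted-model separations.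
- Threatens: every positive-side route whose rank-0 target is "`L ∉ BPP`" for an explicit `L`: it is hypothesis-type by this entry, and
  a crux-ideate/prover seat that tries to PROVE such a target outright is attempting `P ≠ PSPACE`. Planner consequence: mark those targets
  `target`/conditional, staff the membership (`∈ BQP`) and the reductions, never the hardness.
- [g2] Audit 2026-08-16 — the SHARPER FLOOR (Fortnow–Rogers 1999 Thm 3.1, Thm 3.3): `BQP ⊆ AWPP ⊆ PP` with `AWPP` low for `PP`, so a summit witness already
  separates `BPP` from `AWPP`: `not_AWPP_subset_BPP_of_witness`, `BPP_ne_AWPP_of_witness`, `BPP_ne_PP_of_witness`, `BPP_ne_PSharpP_of_witness`,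
  `BPP_ne_PSPACE_of_witness`, packaged `SeparationPrerequisites.sharp_of_facts` (hypotheses = the named facts `BQP_subset_AWPP` — discharged as
  `BQP_subset_AWPP_holds`, `QuantumComplexity/BQPSubsetAWPP.lean` —, `BQP_subset_PP`, `PP_subset_PSharpP`, `PP_subset_PSPACE`). `evasions_known` sharpened:
  conditional bridges; relativized separations; RESTRICTED-MODEL separations that are theorems (shallow circuits — Bravyi–Gosset–König 2D HLF, Watts et al.
  2019 vs `AC⁰` —, communication complexity, two-way finite automata, interactive models up to `MIP* = RE`) — none of which is the uniform summit. Reading: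
  the unconditional content of a positive route is membership + reductions + restricted-model rungs (WeilTwice `BeyondMajority`, SelmerBand `BeyondConstant`,
  HankelLift `BeyondRectangles`, TwoSquaresLadder `TwoSquaresEndOrthogonalAC0`, MobiusLadder 1391–1393 are of this kind); the `L ∉ BPP` apex is `AWPP ⊄ BPP`-hard.

### QA-A04 · Natural proofs — `NaturalProofs` · THEOREM (`NaturalProofs_holds`; content conditional on `HardPRGExist`)
- File: `NaturalProofs.lean`. Statement: `NaturalProofs := Literature.Barriers.PneNP.NaturalProofs` (= tree fact
  `Literature.Computability.Complexity.natural_proofs_barrier`, Razborov–Rudich Thm 4.1: a `P/poly`-natural property useful against `P/poly`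
  makes every `P/poly` PRG family `2^{k^ε}`-easy infinitely often).
- Technique class: natural (constructive + large) properties; combinatorial circuit lower bounds, random restrictions, formal complexity
  measures, gate elimination.
- Kills (conditionally on `Literature.Barriers.PneNP.HardPRGExist`): natural proofs of `BQP ⊄ P/poly` (`NaturalProofs.no_naturalProof_bqp_not_ppoly`),
  of `FACT ∉ P/poly` (`…no_naturalProof_fact`) and of `L ∉ P/poly` for any explicit `L` (`Literature.Barriers.PneNP.NaturalProofs.no_naturalProof_for`);
  instantiated in-tree at `IQ3`: `IqThreeNotPPoly.Negative.no_naturalProof_iqThree` (D15).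
- Escape: the uniform statement `BQP ⊄ BPP` is not a circuit lower bound; non-natural (diagonalization/arithmetization) bounds — which then
  meet A01/A02; almost-natural proofs, hardness magnification; conditional hypotheses untouched.
- Threatens: ArithStatLadder `IqThreeNotPPoly` (2422), MobiusLadder `LiouvilleNotPPoly` (1389) and its rungs (`QuadraticDigitPhases` 1391,
  `DigitPolyUniformity` 1392, `LiouvilleOrthogonalTC0` 1393 are AC⁰/TC⁰-type and below the barrier — fine — but the apex is not),
  YangBaxterIslands (`YbDiagTTToPPoly` 2552 glue), TwoSquaresLadder apex, DeqStabrankPolyImpliesBQPSubsetPPoly-type non-uniform collapses.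
- [g2] Audit 2026-08-16, `NaturalProofsScope.lean`: NARROWED to what is printed and proved — `NaturalProofsNarrow` (`NaturalProofsNarrow_holds`,
  `naturalProofsNarrow_of_naturalProofs`): Γ-natural for Γ ∈ {`P`, `BPP`} (classical constructivity), large, useful against `P/poly`; readings
  `NaturalProofsNarrow.no_naturalProof`, `.no_natural_of_subset_PPoly`, `no_pNatural_of_hardPRG`, `no_bppNatural_of_hardPRG`, `toLanguage_not_mem_PPoly_of_hardPRG`,
  `not_subset_PPoly_of_natural`; fixed-exponent forms `exists_exponent_no_natural_of_subset_PPoly`, `exists_exponent_toLanguage_not_mem_PPoly` (tree fact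
  `Literature.Computability.Complexity.exists_not_natural_usefulAgainstSize_of_hard_prg`, `PNPNaturalProofsFixedExponent.lean`). THE QUANTUM DOOR, typed:
  `quantumNatural_dichotomy` — under `HardPRGExist` a `BQP`-natural property useful against `P/poly` forces `BQP ⊄ P/poly` (`not_bqp_subset_PPoly_of_quantumNatural`)
  and hence THE SUMMIT (`exists_mem_bqp_not_mem_bpp_of_quantumNatural`; fixed exponent `exists_exponent_bqp_not_bpp_of_quantumNatural`,
  `exists_exponent_not_bqp_subset_PPoly_of_quantumNatural`); conversely `no_quantumNatural_of_bqp_subset_PPoly`. That door is CLOSED under the post-quantum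
  hypothesis QHG by the new entry A19. Threat update: WeilTwice/SelmerBand/HankelLift rungs (`BeyondMajority` 16538, `BeyondConstant` 17068, `BeyondRectangles`
  18440) and TwoSquaresLadder `TwoSquaresEndOrthogonalAC0` 16059 sit below the barrier (fine); TwoSquaresLadder's apex `TwoSquaresNotBPP` 16057 is uniform (A03, not A04).

### QA-A05 · Random-oracle method — `RandomOracleMethod` · THEOREM (`RandomOracleMethod_holds`)
- Files: `RandomOracleMethod.lean` (+Proofs, Thm23, Holds). Statement: `fortnowRogers1999_thm44 ∧ aaronsonAmbainis2014_thm7iii` where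
  `fortnowRogers1999_thm44 := (∀ᵐ A ∂randomOracleMeasure, PRel (ofLanguage A) = BQPRel A) → BQP = BPP` and
  `aaronsonAmbainis2014_thm7iii := AAConjecture → P = PSharpP → ∀ᵐ A ∂randomOracleMeasure, BQPRel A ⊆ AvgPRel (ofLanguage A)`.
- Technique class: random-oracle (Bennett–Gill) evidence for or against the summit; unstructured oracles; average-case oracle separations.
- Kills: (a) evidence AGAINST the summit by a probability-1 random-oracle collapse — it already implies `BQP = BPP`
  (`not_ae_P_eq_BQP_of_summit`, `BQP_subset_BPP_of_ae_collapse`); (b) evidence FOR the summit by separating `BQP^A` from heuristic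
  classical polynomial time relative to a random `A`: under `AAConjecture` that refutes `P = P^{#P}` (`P_ne_PSharpP_of_randomOracle_separation`,
  `ae_BQPRel_subset_AvgPRel`) — "as hard as separating complexity classes in the unrelativized world".
- Escape: NP-SEARCH problems (Yamakawa–Zhandry, tree fact `yamakawa_zhandry`) and SAMPLING problems relative to a random oracle; designed
  oracles (Raz–Tal `exists_oracle_BQPRel_not_subset_PHRel`); the AA conjecture is open, so (b) is conditional.
- Threatens: RandomOracleGauge (`RandomOracleHeurSeparation` 1131 is literally `¬` the conclusion of AA Thm 7(iii) — under `AAConj` 10748 it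
  implies `P ≠ P^{#P}`, A03-strength; the route knows and carries AAConj), SosSandwich (`RandomOracleHeurSeparation` 15239;
  `PseudoBoundedAA` 15237 + `TransferPB` 15238 stand in for the AA bridge hypothesis, `AAConjImpliesPBAA` 15245), SpikesNeedAddresses (`WeightedTalagrand` 11699 ⇒ AA ⇒ the separation becomes A03-hard), Refuters
  (`RefOracleNonCollapse` 2037), GenericInertness (generic ≠ random, but the Bennett–Gill transfer shape is the same trap).

### QA-A06 · Strong supremacy theorems / OWF ⇒ separation must be non-relativizing — `SupremacyTheoremsNonRelativizing` · THEOREM (`…_holds`)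
- Files: `SupremacyTheoremsNonRelativizing*.lean`, `FortnowRogers*.lean`, `FFKL*.lean`, `CohenGenericJoin*.lean`, `AaronsonChen*.lean`, `TQBF*.lean`
  (the whole Fortnow–Rogers Cor 3.7 world and Aaronson–Chen Cor 5.2 oracle are PROVED in-tree, incl. `TQBF_isComplete_PSPACE_holds`,
  `fennerFortnowKurtzLi2003_thm618_awpp_holds`, `fortnowRogers1999_cor37_holds`, `aaronsonChen2017_cor52_holds`, `aaronsonChen2017_lem53_holds`).
  Statement: `fortnowRogers1999_cor37 ∧ fortnowRogers1999_thm42 ∧ aaronsonChen2017_cor52` =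
  `(∃ A, PRel (ofLanguage A) = BQPRel A ∧ IsInfinitePHRel (ofLanguage A)) ∧ (∃ C, P^C = BPP^C ∧ BPP^C = BQP^C ∧ P^C ≠ UP^C ∩ coUP^C) ∧ (∃ O, SampPRel (ofLanguage O) = SampBQPRel O ∧ IsInfinitePHRel (ofLanguage O))`.
- Technique class: relativizing PH-collapse arguments ("`BQP ⊆ BPP` ⇒ PH collapses"), Stockmeyer-counting supremacy theorems for
  APPROXIMATE sampling, "one-way functions ⇒ `BPP ≠ BQP`".
- Kills: relativizing proofs of the three evidence templates: `not_relativizes_collapse_template` (FR Cor 3.7: `P = BQP`, PH infinite),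
  `not_relativizes_sampling_collapse_template` (AC Cor 5.2), `not_relativizes_owf_template` (FR Thm 4.2); `exists_oracle_BQPRel_subset_BPPRel_of_cor37`.
- Escape: EXACT / multiplicative-error sampling collapses DO relativize (PostBQP = PP + Toda) — the barrier is specific to additive-error
  sampling; `P/poly` oracles + OWF (A07); the permanent's non-relativizing properties; FR leave "BPP = BQP with CRYPTOGRAPHIC OWFs" open.
- Threatens: ParityFrontier (`TargetGivesBQPnotPH` 1960, `RelFrontier` 1954 — a frontier statement about the RELATIVIZED world is fine, a
  transfer to the unrelativized summit is the template), Refuters (`RefOracleNonCollapse` 2037), WhiteBoxWalk/`WbwThesis` 2238 (planted X ⇒ OWF,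
  D24 `exists_isOneWay_of_wbwThesisPlanted`: the converse direction "OWF-type hypothesis ⇒ advantage" is exactly template (c) unless the
  white-box generator is used non-relativizingly), CommutingDeciders (only if the hardness of its IQP decider `WeightCharacterSignHard` 2642 is ever argued through sampling-hardness / PH-collapse results), GenericInertness
  (`ClassicalInertness` 1826, `BPPSelfLow`), CompactnessLift ("the lift that survives Fortnow–Rogers" — must survive `PlLift`'s oracle too, A08).
- [g2] Audit 2026-08-16, `SupremacyTheoremsNonRelativizingFixedProblem.lean`: the sampling template fails to relativize even PER FIXED PROBLEM — for every
  `D ∈ SampBQP`, `O ↦ (D ∈ SampBPP^O → PH^O collapses)` fails at the Aaronson–Chen world (`SampBQP_subset_SampBQPRel`,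
  `not_relativizes_fixed_sampling_collapse_template`, `…'`, `…_holds`; `not_relativizes_sampBQP_collapse_template`(`_holds`)), and for ANY oracle-indexed
  hypothesis `H`, `O ↦ (H O → collapse)` fails somewhere (`not_relativizes_sampling_collapse_template_with`, `hypothesis_fails_at_ac_world`,
  `exists_oracle_hypothesis_fails`(`_holds`)). Scope restated: relativizing-only; additive-error samplers. COMPANION [g2] A20 `CryptoOWFCollapseWorld`:
  Fortnow–Rogers §4.1's open question (a world with CRYPTOGRAPHIC one-way functions and `BPP = BQP`) typed as the conditional no-go for template (c)
  with cryptographic rather than structural OWFs.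

### QA-A07 · `P/poly`-oracle separations need unrelativized assumptions — `PPolyOracles` · THEOREM (`PPolyOracles_holds`; one conjunct VACUOUS as typed)
- Files: `PPolyOracles*.lean` (Thm 7.6 proved down to HILL: `aaronsonChen2017_thm76_holds`, Zhandry/Servedio–Gortler PRF lines, Boneh–Lipton
  period finding `aaronsonChen2017_lem75_quantum_holds`; Thm 8.1 `aaronsonChen2017_thm81_holds` vacuous, see Scope).
  Statement: `aaronsonChen2017_thm76 ∧ aaronsonChen2017_thm81` = `(OWFExist → PPolyOracleSeparation) ∧ (SampP = SampBQP → NP ⊆ BPP → ∀ O ∈ PPoly, SampPRel (ofLanguage O) = SampBQPRel O ∧ BPPRel (ofLanguage O) = BQPRel O)`;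
  technique-class decls `@[conjecture] PPolyOracleSeparation := ∃ O, O ∈ PPoly ∧ BPPRel (ofLanguage O) ≠ BQPRel O` (OPEN; no `_holds` expected)
  and `PPolyOracleSamplingSeparation` (OPEN).
- Technique class: efficiently computable ("physically realistic") oracles, non-black-box oracle separations, PRF-based worlds.
- Kills: proving advantage "unconditionally" via a `P/poly`-oracle separation: any such proof already proves `SampBPP ≠ SampBQP ∨ NP ⊄ BPP`
  (`not_collapse_of_pPolyOracleSeparation`, `…SamplingSeparation`, `sampP_ne_or_NP_not_subset`); conversely `BPP ≠ BQP` gives it for free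
  (`pPolyOracleSeparation_of_BPP_ne_BQP`, `PPolyOracleSeparationProofs.lean`).
- Escape: a weak assumption suffices (OWF ⇒ `∃ O ∈ P/poly, BPP^O ≠ BQP^O`, `pPolyOracleSeparation_of_owf`); random/unrestricted oracles.
- Scope (important): the tree's `SampP` lets a sampler read advice off its coin budget, so `SampP ≠ SampBQP` is a THEOREM
  (`Literature.Computability.Cryptography.sampP_ne_sampBQP`) and `aaronsonChen2017_thm81` holds vacuously; the printed barrier is about
  `UniformSampP` (`SamplingProblemsUniform.lean`), for which Lemma 8.2 is not discharged. See E07.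
- Threatens: WhiteBoxWalk (`WbwObfuscatedGluedTrees` 2340: iO-obfuscated oracle = a `P/poly` oracle handed out white-box — the crux is
  explicitly conditional on iO+OWF, consistent with this entry), Refuters (`RefPlantedRefuter`), PadKuperberg (`TorsorWitness` 10607: a white-box
  torsor family is an efficiently computable oracle; unconditional hardness `TorsorHard` 0927 of a uniquely-solvable, P-verifiable search problem would imply `NP ⊄ BPP`),
  CodeCarries (`OpiHard` 0995).
- [g2] `PPolyOraclesThm76Frontier.lean` (2026-08-16): the Thm 7.6 chain re-cut at its two genuine inputs — `aaronsonChen2017_lem74_of_HILL` (PRFs from PRGs),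
  `PRPExist_of_luby_rackoff` / `PRPExist_of_PRFExist_holds` (Luby–Rackoff, discharged), `aaronsonChen2017_thm76_of_frontier₂`, `pPolyOracleSeparation_of_frontier₂`,
  `PPolyOracles_of_frontier₂`; together with `PPolyOraclesDischarge.lean` (`PPolyOracles_holds := PPolyOracles_of_HILL PRGExist_iff_OWFExist_holds`, HILL in
  both directions in `Cryptography/PseudorandomGeneratorsAnyOWF.lean`; `aaronsonChen2017_thm76_holds`) the entry is unconditional in the tree, while
  `PPolyOracleSeparation` itself stays `@[conjecture]` (`OWFExist`-conditional: `pPolyOracleSeparation_of_owf`).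

### QA-A08 · The promise lift does not relativize — `PromiseLiftRelativization` · THEOREM (`PromiseLiftRelativization.holds`, axioms standard)
- File: `PromiseLiftRelativization.lean` (new result of this programme, 2026-08-15). Statement:
  `∃ A : Language Bool, BQPRel A ⊆ BPPRel (ofLanguage A) ∧ ¬ (PromiseBQPRel A ⊆ PromiseBPP'Rel (ofLanguage A))`; stronger world
  `exists_oracle_P_eq_BQP_infinitePH_promiseBQP_not_subset` (`P^A = BQP^A`, `PH^A` infinite, `PromiseBQP^A ⊄ PromiseBPP'^A`; `A` = brain oracle of the
  Fortnow–Rogers world ⊕ Cohen generic; Raz–Tal Forrelation window). Decides Aaronson–Arkhipov §10 Q(10) negatively for this world.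
- Technique class: relativizing / structural / promise-completeness proofs of the promise→language lift.
- Kills: every relativizing proof of `PlLift : BQP ⊆ BPP → PromiseBQP ⊆ PromiseBPP'` (stmt-0250; `not_relativizes_promiseLift`,
  `promiseLift_shape_empty_iff`), of the promise collapse (`not_relativizes_promiseCollapse`), and of every RELATIVIZING SUFFICIENT CONDITION
  for the lift, in particular `PlPromiseIsLift : PromiseBQP ⊆ promiseLift BQP` (`not_PromiseBQPRel_subset_promiseLift`); the converse lift holds
  everywhere (`relativizes_promiseLift_converse`). Companion (work file `Cruxes/PlLift/Disproof.lean`, §C06): `not_semanticLiftSchema` — the lift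
  cannot be proved "by monotonicity" from acceptance probabilities (Goldreich's no-gap-off-the-promise obstruction, 3-point model), and
  `not_plLift_iff : ¬ PlLift ↔ (¬ QuantumAdvantage ∧ ¬ (PromiseBQP ⊆ PromiseBPP'))` — a refutation of the lift refutes the summit.
- Escape: none in print; a proof must use white-box structure of a specific `PromiseBQP`-complete promise problem (e.g. a `BQP` LANGUAGE
  separating Aharonov–Jones–Landau instances, route PromiseLift #4 `PlJonesExtends` 11236).
- Threatens: `PlLift`/`PromiseLanguageLift`/`WbwPromiseLift` stmt-0250 (routes PromiseLift r2, CodeCarries r5, RandomOracleGauge r4,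
  WhiteBoxWalk r4, ExponentLadder r5, SpikesNeedAddresses r6, SosSandwich r5; CubicForrelation support r6), `PlPromiseIsLift` 11235,
  `PromiseTransfer` 10749/11702, `OpiLiftPromise` 0993 → `OpiLiftLang` 0996, `UniformExponentLift` 18126 (CompactnessLift, [g2]: the originally filed `CompactnessPrinciple` 15270 was PROVED by coin padding and
  carries no content, C13; `PlImpliesCp` 15273 made CP a consequence of PlLift; the re-typed uniform-exponent lift over honest `BQTime/BPTime` fails relative to
  `A` unless it is non-relativizing — its why-might-fail line requires it to hold in THIS oracle world; state where), `SignedExactSliceIsLift` (PROVED, C05: a genuine white-box lift for one slice).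

### QA-A09 · No superpolynomial black-box speedup on total functions — `TotalFunctionSpeedupLimit` · THEOREM (`TotalFunctionSpeedupLimit_holds`, constant 4096)
- File: `TotalFunctionSpeedupLimit.lean`. Statement: `TotalFunctionSpeedupLimit := bealsEtAl2001_thm54 := ∀ N (f : (Fin N → Bool) → Bool), detQueryComplexity f ≤ 4096 * (quantumQueryComplexity (1/3) f) ^ 6`;
  class `TotalSpeedupBeyond d`; readings `TotalFunctionSpeedupLimit.not_totalSpeedupBeyond_six`, `not_totalSpeedupBeyond_four` (ABKRT, tree fact
  `detQueryComplexity_le_pow_four`, quantum-advantage.S12), `randQueryComplexity_le_of_thm54`.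
- Technique class: query/black-box complexity of TOTAL Boolean functions (and symmetric partial functions, AA Thm 27, not typed).
- Kills: exponential oracle separations or speedups sourced from unstructured/total problems (OR, parity, majority, collision-free search).
- Escape: STRUCTURE — partial functions / promises (Simon, period finding, Forrelation `raz_tal_forrelation`), `BQP`-complete problems; the
  quartic exponent is tight.
- Threatens: WhiteBoxWalk's engine (`WbwVerifiableLineNoSpeedup` 2239 is a PROMISE problem and was proved with `min(T, √2^m)` — consistent),
  HiddenSpread (`SpreadShiftQueryLB` 2454 — partial function, fine, but any "total" reformulation dies), SosSandwich/SpikesNeedAddresses (their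
  AA-type statements are about ALL bounded low-degree polynomials = the total-function regime where only polynomial gaps live — consistent,
  that is the point), GenericInertness (`InertnessMachine` 10362), NeedleThreshold (`NeedleDetector`).
- [g2] Audit 2026-08-16 ("where the barrier stops"): NARROWED to total Boolean FUNCTIONS = decision tasks with exactly one correct answer per input; the
  `technique_class` / `evasions_known` / `scope_caveats` lines now say so, and the relational escape is typed as the named fact `yamakawaZhandry2022_totalSearch`
  (Yamakawa–Zhandry 2022: an `NP` SEARCH problem, total, with an exponential quantum/classical query separation relative to a random oracle; readings
  `yamakawaZhandry2022_totalSearch.not_polynomially_related` and the function/relation dichotomy). So "total" does not protect a classical engine against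
  RELATIONS or SAMPLING tasks; the entry is about query COUNT only — nothing about time, white-box problems or the summit's machine classes directly.

### QA-A10 · Bounded multipartite entanglement (Jozsa–Linden) — `jozsaLinden2003_pblocked` · THEOREM (`jozsaLinden2003_pblocked_holds`, BoundedEntanglementHolds.lean)
- Files: `BoundedEntanglement*.lean` (quantum half), `PBlockedSim*.lean`, `PSimFP*.lean` (machine half in typed `CodeFP`). Statement:
  `∀ p F L, F.IsOracleFree → F.IsUniform → F.IsPolySize → F.HasPBlockedStates p → (F decides L with gap (2/3,1/3)) → L ∈ BPP`
  (`IsPBlocked p ψ`: wires partition into blocks of ≤ p qubits across which ψ is a product).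
- Technique class: witnessing the summit with pure-state algorithms whose states never entangle more than `p` qubits jointly (covers
  "only bipartite entanglement" and distributed pure-state computing with `≤ p`-qubit nodes).
- Kills: any `L ∈ BQP ∖ BPP` witnessed by such a family — it is in `BPP`.
- Escape: unboundedly growing multipartite entanglement (Shor); MIXED-state computations (DQC1-type) are outside the theorem; entanglement is
  necessary, not sufficient (Gottesman–Knill, matchgates).
- Threatens: witness-design cruxes of positive routes — CommutingDeciders (`CommutingWitness` 2639: one-shot IQP deciders are highly entangled, fine,
  but say so), YangBaxterIslands (`YbIsland` 2549 / `YbFreeFermionLine` 2553), SeparableFrames-type one-clean-qubit ideas (B04; mixed states are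
  exactly the documented gap of this entry — an honest evasion, but B04 shows the frame mechanism for it is dead).

### QA-A11 · Low treewidth / log-depth local circuits (Markov–Shi) — `markovShi2008_cor15`, `markovShi2008_cor15_anyOrder`, `markovShi2008_prop51`, `markovShi2008_thm46` · THEOREMS (`…_holds` ×4)
- Files: `TensorNetworkContraction*.lean` (22 files; contraction engine in exact `ℤ[ω]` arithmetic, junction trees, path decompositions, all in `CodeFP`).
  Statements (language level): `cor15`: uniform poly-size oracle-free Clifford+T families that are `q`-local-interacting (fixed wire order) and of
  depth `≤ c·log₂ n + c` decide only languages in `P`; `cor15_anyOrder`: same with the ordering existentially quantified per `n`;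
  `prop51`: cut parameter `≤ c log₂ n + c` under an `FP`-SUPPLIED wire indexing, NO depth bound ⇒ `L ∈ P`; `thm46`: contraction theorem with the
  rooted tree decomposition supplied (width `≤ c log₂ n + c`) ⇒ `L ∈ P`. Reductions: `markovShi2008_prop51_of_anyOrder`,
  `markovShi2008_cor15_of_anyOrder`, `markovShi2008_cor15_anyOrder_of_prop51_anyOrder`, `markovShi2008_cor15_supplied_of_prop51`,
  `treewidth_circuitGraph_le` (`tw(G_C) ≤ 2r+1`).
- Technique class: witness families whose tensor network has small treewidth (constant-range architectures of log depth, log-treewidth families,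
  contractible finite instances — the 2019 Sycamore instance is documented as classically reproduced).
- Kills: such families as summit witnesses (they decide languages in `P`); "any poly-size circuit computing a classically hard function has
  super-logarithmic treewidth".
- Escape: super-logarithmic treewidth (deep or long-range); 2D constant-depth ≥ 3 gate layers is OUTSIDE (planar grids have linear bandwidth;
  `#P`-hard amplitudes at depth 3; BGK18 2D-HLF); for the single-output decision form the real content is the LIGHT CONE (`O(log n)` qubits), the
  genuine tensor-network content is Prop 5.1 (log cut parameter, arbitrary depth, e.g. ladder circuits).
- Threatens: witness typing of CommutingDeciders, YangBaxterIslands (brickwork of poly depth: escapes by depth, but `YbDiagTT` diagonal-to-diagonal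
  transfer matrices are a cut-parameter question), DyadicGap (`HadamardTestFamily`), any "shallow witness" idea.

### QA-A12 · Lattice rigidity of the Toffoli+Hadamard gate group — `latticeRigidity_finiteImage` · THEOREM (`latticeRigidity_finiteImage_holds`, LatticeRigidityProofs.lean; elementary proof, not superrigidity)
- Files: `LatticeRigidity*.lean`. Statement: `∀ n ≥ 3, ∀ d < 2^n, ∀ ρ : toffoliHadamardGroup n →* GL (Fin d) ℂ, (Set.range ρ).Finite`
  (`toffoliHadamardGroup n = O_{2ⁿ}(ℤ[1/2])`, exactly the operators of `{X, CX, CCX, H⊗H}`+ancilla circuits, Amy–Glaudell–Ross 2020);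
  consequences `….finite_range_of_factorsThrough`, `….finite_range_unitary`, `….finite_range_qubits`, `….not_injective_of_infinite`;
  witnesses `LatticeRigidity.infinite_dyadicOrthogonalGroup` (N ≥ 5), finiteness of `Γ₄` (nothing below 3 qubits).
- Technique class (¬side): classical simulation / dequantization schemes that FACTOR THROUGH A COMPRESSED LINEAR SHADOW of the gate group — a
  homomorphism `ρ : Γ_{2ⁿ} → GL_d(ℂ)`, `d < 2ⁿ` (the algebraic form of tableaux for Cliffords and `SO(2n)` for matchgates).
- Kills: every such scheme for `n ≥ 3`: the shadow has finite image, so any statistic computed from it takes finitely many values over all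
  circuits; no homomorphic simulation of `n`-qubit Toffoli+H by unitaries on `m < n` qubits.
- Escape: non-homomorphic simulators (state depends on the circuit WORD: stabilizer-rank decompositions, tensor networks, quasi-probability) —
  untouched; non-universal gate groups (Clifford, matchgates); `n ≤ 2`. Exact homomorphisms only (no ε-stability claimed).
- Threatens: ModularRank (`ModularSimulation` 1791 reduces mod `p ≡ 1 (8)` — a ring homomorphism on AMPLITUDES, not a group homomorphism to
  `GL_d` with `d < 2ⁿ`, so it escapes nominally; but any "track a small matrix instead of the state" variant is this class), YangBaxterIslands
  (`YbDiagTT` transfer matrices), any new ¬side card proposing a "generalised tableau".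

### QA-A13 · Uncorrected noise — `bremnerMontanaroShepherd2017_thm4` · THEOREM (`bremnerMontanaroShepherd2017_thm4_holds`, UncorrectedNoiseProofs.lean)
- Files: `UncorrectedNoise*.lean` (10 files; the noisy-IQP simulating machine in `FP`). Statement: for every UNIFORM `{Z,CZ,T}`-IQP family whose
  output distributions anti-concentrate at level `α` (`collisionMass ≤ α/2^N`), every fixed bit-flip rate `η ∈ (0,1/2]` and accuracy `δ > 0`,
  some PPT algorithm samples within total variation `δ/2` of the noisy output distribution on every input.
- Technique class: (A) scalable advantage claims from constant-rate-noise sampling devices (RCS, IQP, BosonSampling without fault tolerance) argued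
  via anti-concentration + average-case hardness; (B) noise-AGNOSTIC robustness proofs (polynomial interpolation, any convex method) for
  average-case `#P`-hardness of output probabilities.
- Kills: (A) as typed for IQP; in print also RCS (Aharonov et al. 2023 Thm 1) and noisy BosonSampling (Kalai–Kindler); (B) "any noise-agnostic
  technique cannot prove sufficient robustness" (Bouland–Fefferman–Landau–Liu 2022 Thm 7/8), plus the depth barrier of Napp et al.
- Escape: fault tolerance (then A14 bounds the rate); classical error correction inside IQP (BMS Thm 5); sub-logarithmic depth (no
  anti-concentration); non-unital noise; depth- and noise-sensitive techniques.
- Threatens: only arguments that lean on finite/noisy experiments as evidence; CommutingDeciders if its IQP witness is ever argued "robust to noise".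

### QA-A14 · Upper bounds on the fault-tolerance threshold — `NoiseThresholdUpperBounds := kempeRegevUngerDeWolf2008_thm1` · THEOREM (`NoiseThresholdUpperBounds_holds`, `kempeRegevUngerDeWolf2008_thm1_holds`)
- Files: `NoiseThresholdUpperBounds*.lean`. Statement: `∀ k ≥ 1, ∀ ε₁ > 0, ∀ εk > kruwThreshold k, ∃ c > 0, ∃ T₀, ∀ n (C : NoisyCircuit n k), C.RatesAtLeast ε₁ εk → T₀ ≤ C.depth → ∀ ρ τ densities, |C.probOne ρ − C.probOne τ| ≤ 2^{−c·depth}`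
  (`kruwThreshold k = 1 − √(2^{1/k} − 1)`: 35.7 % for `k = 2`); reading `NoiseThresholdUpperBounds.eventually_no_gap` (no `(2/3,1/3)` gap beyond depth `T₁`).
- Technique class: fault tolerance / QEC as the evasion of A13, at physical noise above explicit constants (also Razborov 2004 `η > 1 − 1/k`;
  Buhrman et al. 2006 45.3 % for noisy one-qubit gates + perfect Cliffords — cited, not typed).
- Kills: any witness of the summit (or proxies) by devices that noisy, whatever the encoding or magic-state supply.
- Escape: noise below threshold (threshold theorem; two orders of magnitude between bounds); magic-state distillation below 45.3 %; fresh qubits.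
- Threatens: nothing in the current route list directly (no route argues through physical noise); listed for ideators.
- [g2] Audit 2026-08-16: NARROWED, and one reading REFUTED — `NoiseThresholdUpperBoundsNarrow` (a THEOREM; status established-narrowed) = (i) the decision-gap
  reading `eventually_no_gap` of Kempe–Regev–Unger–de Wolf Thm 1 for wire-noise rate `ε₁ > 0` on EVERY wire, conjoined with (ii) the REFUTATION of the same
  reading with noise-exempt wires: `kempeRegevUngerDeWolf2008_thm1_false_of_eps1_zero` (`ε₁ = 0` allowed ⇒ false at every depth; witness `kruwIdleLevel` /
  `kruwIdleCircuit`: an idle noiseless qubit keeps a perfect `(2/3, 1/3)` gap, `kruwIdleCircuit_run`, `kruwIdleCircuit_ratesAtLeast T 0 εk`),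
  `NoiseThresholdUpperBoundsNarrow.no_gap`, `.gap_without_wire_noise`. Scope: the three printed models (KRUW, Razborov 2004, Buhrman et al. 2006) are pairwise
  incomparable; non-adaptive circuits, no noiseless classical control, no fresh ancillas mid-circuit. Escape accordingly: noiseless classical side-processing /
  fresh qubits / sub-threshold noise; pattern E08 (noise on every wire is load-bearing).

### QA-A15 · Linear XEB can be spoofed / does not certify — `linearXEB_not_certifying` · THEOREM (proved in `LinearXEBSpoofing.lean`; no named fact)
- Statement: for every distribution `q` on a finite outcome space and every mode `m` of `q`: the point mass at `m` maximises `linearXEB q ·`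
  over ALL distributions (`linearXEB_le_linearXEB_single`) and is at total variation `1 − q(m)` from `q` (`halfL1_single_eq`); also
  `linearXEB_uniform = 0`, `linearXEB_depolarize : F_q(F·p + (1−F)·u) = F · F_q(p)`, `abs_depolarize_sub_uniform`.
- Technique class: certifying a finite RCS experiment as classically intractable THROUGH THE LINEAR CROSS-ENTROPY BENCHMARK ALONE (XQUATH frame).
- Kills: reading an XEB score as evidence for the summit or for `SampBPP ≠ SampBQP` beyond what the benchmark certifies; in print:
  Barak–Chou–Gao `poly`-time `ω(1)` XEB for 2D depth `O(√log n)`, Gao et al. spoofing, Pan–Chen–Zhang tensor-network sampling at fidelity 0.0037,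
  Aharonov et al. (noisy RCS indistinguishable by XEB/HOG; XQUATH refuted in that setting).
- Escape: conditional spoofing hardness (XQUATH); weak-noise phase at 67 qubits/32 cycles; efficiently VERIFIABLE tasks (Yamakawa–Zhandry).
- Threatens: evidence sections of route theses only.

### QA-A16 · No free frame (flat Pauli spectra defeat Clifford / matchgate frames) — six entries, all PROVED Summits-side (route SymplecticPurity, retired 2026-08-16 "retire-with-barriers")
Named facts in `Literature` (Literature cannot import Summits); discharges are the Summits theorems named in each `status:` line.
- `noFreeFrame` (`NoFreeFrame.lean`; = item stmt-10731, proof `Summit.….Theorems.SymplecticPurity.noFreeFrame_proof`): it is FALSE that every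
  uniform oracle-free Clifford+T family admits `c` such that at every input/stage some semantic-Clifford frame `U` makes EVERY linear cut of
  `U·(F.stateAfter x j)` have purity `≥ 1/(|x|^c + c)` (statement abridged; witness: the uniform cube family loading `Σ_y |y⟩|y³⟩` over
  `𝔽₂[X]/(Φ_{3^{k+1}})`, every Clifford frame has a cut of purity `≤ 5·2^{−n/2}`).
  technique_class: the FREE-FRAME ROAD — (Clifford frame)·(poly-bond MPS) representations of the states of uniform BQP computations (CAMPS,
  Clifford-DMRG/TDVP, stabilizer tensor networks, Clifford disentangling) + Gottesman–Knill + MPS contraction. blocks: `H_FF`, hence any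
  "`BQP ⊆ BPP` via free re-framing of all uniform families" argument.
- `symplecticPurityBound` (`NoFreeFramePurityBound.lean`; stmt-10729, `…SymplecticPurityBound_proof`): a unit `ε`-flat `n`-qubit state
  (`|⟨ψ|σ_S|ψ⟩| ≤ ε` for all `S ≠ I`), tensored with `|0^m⟩` and rotated by ANY semantic Clifford `U` on `n+m` qubits, has a linear cut of purity
  `≤ 4ε` — entanglement you cannot rotate away; any order, any stabilizer ancillas.
- `gaussianDegreeBound` (`NoFreeFrameGaussianBound.lean`; stmt-9838): fermionic-Gaussian (matchgate) frames do not compress initial blocks of flat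
  states: block `{wires < d}` of `Uψ` has purity `≤ (1 + ε² Σ_{k=1}^{2d} C(2n,k))/2^d`.
- `graphStateSpectrum` (`NoFreeFrameSBoxSpectrum.lean`; stmt-9840): the S-box dictionary — for `f : 𝔽₂ⁿ → 𝔽₂ⁿ` with differential uniformity `≤ D`
  and linearity `≤ Λ`, the data-loading vector `Σ_x |x⟩|f(x)⟩` has `|⟨g|σ_S|g⟩| ≤ max(D, Λ)` for every `S ≠ I` (DDT/LAT read quantumly).
- `cubeAlmostBent` (`NoFreeFrameCubeAlmostBent.lean`; stmt-9841; Gold/Nyberg, published): `x ↦ x³` on `𝔽_{2ⁿ}` is APN (`≤ 2` solutions) and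
  near-bent (`|Walsh| ≤ 2√2ⁿ`).
- `cubeGraphFlat` (`NoFreeFrameCubeGraphFlat.lean`; stmt-9836): the cube data-loading state is `2^{1−n/2}`-flat.
- Kills (jointly): free Clifford frames (any order, any stabilizer ancillas: bond `≥ 2^{n/2−3}` on the cube family), free matchgate frames
  (initial blocks), and every technique that needs a peaked/sparse Pauli spectrum of cheaply generated arithmetic data states (Pauli-path
  truncation, low stabilizer entropy/nullity) — ON THIS FAMILY.
- Escape (= the two ex-cruxes left UNDECIDED at retirement, both closed `moot`): composite Clifford∘Gaussian∘Clifford frames (`CompositeFrameBound`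
  stmt-10730, Negative lemmas D03) and algorithm-specific states such as Shor's `Σ|x⟩|g^x mod p⟩` (`DlogGraphFlat` stmt-10732 — flatness of
  modular exponentiation undecided); approximate/robust versions not vendored; simulators that are not frame+MPS representations.
  Conditional extension (C08): `SymplecticPurityDeqThesisRoadKill.roadLFF_false_of_coreBalancedFlat` kills the LU-DRESSED road modulo one open stub.
- Threatens: the ¬side island routes PauliFlat (`DigitWalshFlat` 1988, `ProductFrameFlat` 1989, `KappaTypical` 1990, `NegPauliTruncation` 1993 —
  PauliFlat needs Pauli-flatness of MULTIPLICATION states to FAIL in a usable way; `graphStateSpectrum` says flatness is the differential/linear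
  profile, so `ModMulPauliRank` 1987 is an S-box question), XorDarkCharacters (`CharStateFlat` 9870 etc. are flatness STATEMENTS — they feed kills,
  consistent), RectangleFree (`LimClassesEveryOrder` 9743: cut rank in every order — `symplecticPurityBound` is the Clifford-frame analogue),
  ShorLocallyDark (`WorkDigitsEquidistributed` 8594; dark marginals = flat low-weight spectrum ⇒ by this entry NO free frame helps — the route
  must name a non-frame simulator), Dequantize/ModularRank (stabilizer rank is NOT a frame method — escapes (b)), AmplitudeProofs.

### QA-A17 · Tombstone — `SampPRel_empty : SampPRel Oracle.empty = SampP` · REFUTED as formalised (`not_SampPRel_empty`, SupremacyTheoremsNonRelativizingSampPRel.lean)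
- Why false: the tree's `SampP` quantifies over `RandAlg`s with `IsPPT A id`, which only BOUNDS the coin budget `coinLen : ℕ → ℕ` (advice off the
  coin count) ⇒ uncountable (`Literature.Computability.Cryptography.not_countable_sampP`), while `SampPRel ∅` is countable (`sampPRel_countable`).
  Corrected bridge PROVED: `SampPRel_empty_uniform : SampPRel Oracle.empty = UniformSampP` (`SampPRel_empty_uniform_holds`). Same model
  feature makes `sampP_ne_sampBQP` a theorem (A07 scope) and gives `IsPPT`/`IsPolyTime` adversaries `O(log n)` bits of length-indexed advice
  (D18 `isPolyTime_outputs_any_unary_predicate`, D23 `coinCounter_isPPT`). See E07.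
- Kills: any statement whose truth hinges on `SampP`/`IsPPT` being a class of uniform machines. Escape: type `UniformSampP` / ask for a computable coin polynomial.

### QA-A18 · Tombstone — `DegreeOnePrimesEscapeWithoutProper` · REFUTED (`DegreeOnePrimesEscapeWithoutProper_false`, alias `not_degreeOnePrimesEscapeWithoutProper`; DegreeOnePrimesEscapeNeedsProperness.lean; also `degreeOnePrimesEscape_false_without_proper`, D06)
- Statement (deprecated def, never a hypothesis): the crux `LinnikCubicClassGroups.DegreeOnePrimesEscape` (stmt-11543) with `M ≠ ⊤` deleted:
  `∀ n, ∃ C, ∀ K (deg n, no quadratic subfield), ∀ x ≥ |d_K|^C, ∀ M ≤ Cl(K), π(x) ≤ 8 · #{degree-one primes of norm ≤ x with class ∉ M}`.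
  False at `n = 1`, `K = ℚ`, `x = 2`, `M = ⊤`.
- Kills: the hypothesis-free variant; any line that forgets properness. Escape: keep `M ≠ ⊤` (the crux itself is open, conditionally proved via
  Thorner–Zaman + Stark per the route header).

### QA-A19 · [g2] Quantum natural proofs — `QuantumNaturalProofs` · THEOREM (`QuantumNaturalProofs_holds`, QuantumNaturalProofs.lean, 2026-08-17; content conditional on the post-quantum hypothesis QHG)
- File: `QuantumNaturalProofs.lean` (reversible compilation `RevB2.compile` of `B₂` circuits into Clifford+`T` with clean ancillas, `quantumPrgAdvantage` /
  `quantumPrgHardness : ℕ∞`, main theorem `quantum_natural_proofs_barrier`). Statement: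
  `QuantumNaturalProofs := ∀ Q : CombinatorialProperty, IsNatural BQP Q → IsUsefulAgainstPPoly Q → ∀ G : PRGFamily, G.IsInPPoly → ∀ ε > 0, ∃ᶠ k in atTop, quantumPrgHardness (G k) < ⌈2^{k^ε}⌉₊`
  — Razborov–Rudich Thm 4.1 with a QUANTUM test: the `Γ = BQP` case that A04 / `NaturalProofsNarrow` do not cover (Arunachalam–Grilo–Gur–Oliveira–Sundaram 2021
  Def 10–12 "quantum natural property"; Chia–Chou–Zhang–Zhang 2022 Thm 1.4 §4.1.2; Arora–Barak Thm 23.1).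
- Readings: `no_quantumNatural_of_qHardPRG` (QHG ⇒ no `BQP`-natural property useful against `P/poly`), `exists_exponent_no_quantumNatural_of_qHardPRG`,
  `no_natural_of_subset_BQP` (any constructivity class `Γ ⊆ BQP`: `P`, `BPP`, `EQP`, `BQP`), `no_pNatural_of_qHardPRG`, `no_bppNatural_of_qHardPRG`,
  `quantumNatural_door_closed` (the right disjunct of A04's `quantumNatural_dichotomy` is empty under QHG), `not_quantumHard_of_quantumNatural` (contrapositive:
  a quantum natural proof BREAKS every `P/poly` generator quantumly), `hardPRGExist_of_qHardPRG` (QHG ⇒ `Literature.Barriers.PneNP.HardPRGExist` with exponent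
  `ε/2`: A19's hypothesis dominates A04's), `no_naturalProof_of_qHardPRG`.
- Technique class: quantum-natural-proofs; `BQP`-natural (constructive-in-`BQP` + large) properties; MQCSP-in-`BQP`-style arguments; quantum learners /
  distinguishers used as lower-bound engines against `P/poly`.
- Kills (conditionally on QHG = "some generator family in `P/poly` is `2^{k^ε}`-hard against QUANTUM adversaries", inline hypothesis of the section docstring,
  to be registered as `QuantumHardPRGExist`): every lower-bound argument for `BQP ⊄ P/poly`, `FACT ∉ P/poly`, `IQ3 ∉ P/poly`, `L_λ ∉ P/poly`, … whose
  discriminating property is decidable in quantum polynomial time on truth tables — in particular the one door A04 left open towards the SUMMIT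
  (`exists_mem_bqp_not_mem_bpp_of_quantumNatural`) is shut.
- Escape: (1) QHG may FAIL — it is a post-quantum assumption (factoring/DLOG-based generators are no evidence; LWE/LWR-type candidates are); (2) constructivity in
  `QMA` / `QCMA` / `BQP/qpoly` / `coNP` is not covered; (3) PROMISE quantum natural properties and quantum LEARNERS (AGGOS Question 2) are not covered by the proof;
  (4) non-large / almost-natural properties, hardness magnification; (5) the uniform summit `BQP ⊄ BPP` is not a circuit lower bound at all (A04's escape, unchanged).
- Threatens: the `∉ P/poly` apexes of A04 — ArithStatLadder `IqThreeNotPPoly` 2422 (line `Sketch` apex `SQF ∉ P/poly`, C14), MobiusLadder `LiouvilleNotPPoly`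
  1389 (apex of `NP ⊄ P/poly` strength, C14), YangBaxterIslands glue (`YbDiagTT…`), TwoSquaresLadder — now ALSO when the proposed distinguishing property is
  "quantumly checkable" (period / character / class-number statistics decided by a quantum algorithm on the truth table): such a property is `BQP`-natural and
  dies under QHG. An ideator proposing "use the quantum algorithm itself as the natural property" must name which of (1)–(4) the card bets on.

### QA-A20 · [g2] A world with cryptographic one-way functions and `BPP = BQP`? — `CryptoOWFCollapseWorld` · OPEN QUESTION typed as a conditional no-go (CryptoOWFCollapseWorld.lean, 2026-08-17; no named fact, existence NOT asserted)
- File: `CryptoOWFCollapseWorld.lean`. Decls: `CryptoOWFCollapseWorld (A : Language Bool) : Prop := OWFExistRel (Oracle.ofLanguage A) ∧ BQPRel A ⊆ BPPRel (Oracle.ofLanguage A)`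
  (a relativized world with honest CRYPTOGRAPHIC one-way functions — secure against `BPP^A` inverters — in which `BQP^A` collapses), `CryptoOWFCollapseWorldNonuniform`
  (OWFs secure against `P/poly^A` inverters; implies the uniform one, `CryptoOWFCollapseWorldNonuniform.cryptoOWFCollapseWorld`). Fortnow–Rogers 1999 §4.1 leave the
  existence of such an `A` OPEN (their Thm 4.2 world has only structural `P ≠ UP ∩ coUP` one-way functions: A06 template (c)).
- Theorems: `not_relativizes_cryptoOWF_template_of` / `not_relativizes_cryptoOWF_summit_template_of` (IF such a world exists, "cryptographic OWF ⇒ `BPP ≠ BQP`"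
  resp. "⇒ the summit" does not relativize), `exists_cryptoOWFCollapseWorld_iff_not_relativizes`(`_summit`) (the existence question IS the relativization question
  for this template — either answer is informative), `not_relativizes_cryptoOWF_template_nonuniform_of`, `…_template_of_nonuniform`,
  `exists_cryptoOWFCollapseWorldNonuniform_iff_not_relativizes`, `exists_cryptoOWFCollapseWorld_iff_canonical`, `cryptoOWFCollapseWorld_iff_eq'` (collapse as an
  equality given `BPP^A ⊆ BQP^A`).
- Technique class: "crypto ⇒ quantum advantage" transfers — OWF / PRG / PRF / iO-based arguments that a primitive secure against CLASSICAL adversaries forces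
  `BPP ≠ BQP`, argued relativizingly.
- Kills: nothing unconditionally yet (status: open question; conditional companion of A06 (c)). It is the precise statement a route of that class must either
  REFUTE (show no such world exists — a non-relativizing fact about one-way functions) or EVADE (use the code of the primitive). Escape: post-quantum INSECURITY used
  white-box (Shor breaks the specific OWF — the Shor bridge, conditional and fine); a quantum-SECURE primitive gives no advantage by itself.
- Threatens: WhiteBoxWalk (`WbwCryptoPremise` 18372, `WbwObfuscatedGluedTrees` 2340: iO + puncturable PRF + injective OWF ⇒ clause (C) — the premises are
  post-quantum-flavoured and the generator is used white-box; the route should record that its conclusion fails in a `CryptoOWFCollapseWorld` if one exists, i.e.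
  which step reads code), HiddenSpread (`ObfuscatedSpreadInstantiation` 2638, `CertifiedSpreadLeakage` 17598, `SpreadIdealQueryBound` 17591), PadKuperberg
  (`TorsorHard` 0927), CodeCarries (`OpiHard` 0995), Refuters (`RefPlantedRefuter`).

---------------------------------------------------------------------------------------------------------------------------------

## Part B — Refuted route statements (`ledger negatives --problem QuantumAdvantage`; `Theorems/*Refutation.lean`; all `theorem …_refuted : ¬ <Theses decl>`)

### QA-B01 · `CubicForrelation.CubicStability` (stmt-2202) — REFUTED, substantive · `Summit.QuantumAdvantage.QuantumAdvantage.Theorems.CubicForrelationCubicStability_refuted` (CubicForrelationCubicStabilityRefutation.lean; witness files `Theorems/CubicStability/Negative/{P4Witness,P4Facts}.lean`; kit j007630) · route CubicForrelation: item DROPPED, route repaired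
- Statement: for even `n` and cubic `f g` (ANF degree ≤ 3 via `MvPolynomial … totalDegree ≤ 3`) with `3/5 ≤ forrelation f g`, some EXACTLY
  forrelated cubic pair `(f₀,g₀)` (`Φ = 1`) has `4·#{f ≠ f₀} ≤ 2ⁿ` and `4·#{g ≠ g₀} ≤ 2ⁿ`.
- Witness `P₄` (n = 12, four blocks of 3 bits): `a = Σ_k [wt(x^k)=2]`, `b = Σ_k x^k₁x^k₂x^k₃`; `Φ(a,b) = 625/1024 ≥ 3/5` (`yes_fA_gB`) yet NO bent
  function lies within Hamming distance `2ⁿ/4` of `b` (Parseval + dual bentness at 29 Walsh points + weighted count `29184 > 28928`).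
- Kills: stability/inverse theorems for cubic Forrelation at the filed constants `(3/5, 1/4)`; "sporadic forrelated cubic pairs far from every
  bent/dual pair exist". Also load-bearing (D05): `not_cubicStability_without_even` (parity of `n`). `P₄` moreover has NO half-dimensional
  M-subspace on either side (`residue_witness_P4`, D19).
- Escape / repair: missed by the witness — YES threshold `2/3` (truth open); the route moved the structural crux to the TOP of the promise:
  `NearExactIsExact` (stmt-14043, `∃ θ < 1`, D16: θ ≥ 15/16 forced).

### QA-B02 · `SpinorFlattening.GaussRankPolyThesis` (stmt-1244, the route's TARGET X) — REFUTED, substantive (designed kill) · `…Theorems.SpinorFlatteningGaussRankPolyThesis_refuted` @1fc1f4666c4c · route SpinorFlattening CLOSED refuted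
- Statement (named API, `crux_iff_named`): for every `δ > 0` there is `c` such that for all `t` some linear combination of `≤ t^c + c` fermionic
  GAUSSIAN states (`IsGaussian`: nonzero, `n` linearly independent annihilating Majorana rows) is `δ`-close (`normSq ≤ δ²`) to `|M⟩^{⊗t}` (`magicMPow t`,
  `|M⟩ = (|0000⟩+|1111⟩)/√2`).
- Refuting theorem = PROVED kill item `NegApproxGaussRankSuperpoly` (stmt-1245, `SpinorFlattening.NegApproxGaussRankSuperpoly_of`, closed PROVED):
  at `δ = 1/2` every `≤ t^c + c`-term Gaussian combination stays at squared distance `> 1/4` for some `t` (Bessel mass bound + CAR normal-ordering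
  deficiency + flat orthonormality + binomial count: `‖M^{⊗t} − φ‖² ≥ 1 − r·D_K(4t)/(C(t,K)8^K)`), composed through
  `GaussRankPolyImpliesPPoly.Negative.GaussRankPolyThesis_false_of_negApprox` (D11). Independent route to the same kill: the Gaussian FIDELITY
  bound `magicPowFidelityBound_holds : |⟨M^{⊗t}, g⟩|² ≤ 2^{−t}‖g‖²` (Cudby–Strelchuk Lemma 3, proved in-tree from the annihilator definition, D11)
  and `not_polyCoeffThesis` (poly-COEFFICIENT version false unconditionally).
- Kills: `BQP ⊆ BPP` by matchgate/fermionic-linear-optics + polynomial approximate Gaussian RANK of magic states; the whole "Gaussian-rank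
  dequantization" road (also its `P/poly` form, D11 `RefutationShape`). Escape: none for `|M⟩`; other magic states / other simulators untouched.

### QA-B03 · `KummerSector.KsNotFrobenian` (stmt-1615) — REFUTED, misstated · `…Theorems.KummerSectorKsNotFrobenian_refuted` @489ebb6d16e0 · item DROPPED, repaired as `KsNotFrobenianR` (stmt-10865)
- Statement: for every modulus `m ≥ 1` and EVERY finite list `fs : List (Polynomial ℤ)`, Kummer's class I (`√p < Σ_x cos(2πx³/p)`) is not eventually
  a function of `(p mod m, root counts of the f ∈ fs mod p)`.
- Witness: `m = 1`, `fs = [0]` — the zero polynomial has root count `p`, which determines `p`; `D := image`, `N := 0`.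
- Kills: nothing mathematical — a typing trap (E02). Escape: `∀ f ∈ fs, f ≠ 0` (`KsNotFrobenianR`; then the genuine open Patterson-type claim).

### QA-B04 · `SeparableFrames.TwoQubitFrameExactness` ("κ₂ = 1", stmt-9863) — REFUTED, substantive · `…Theorems.SeparableFramesTwoQubitFrameExactness_refuted` @f92389067068 · route SeparableFrames CLOSED refuted
- Statement: for every Hermitian two-qubit `A`, (`1 + A` and `1 − A` fully separable, i.e. in the `IsPBlocked 1` cone) ↔ (`A ∈ convexHull` of
  LOCC-tree contractions `Σ ε_{ac} |u_a ⊗ v_{ac}⟩⟨u_a ⊗ v_{ac}|`, `|ε| ≤ 1`).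
- Witness: X-state direction `A = [[−5/8,0,0,−3/4],[0,1/4,0,0],[0,0,1/4,0],[−3/4,0,0,1/2]]`, explicit product decompositions of `1 ± A`, separating
  functional `L = Re tr((1 − |χ⟩⟨χ|)·)`, `χ = 2|00⟩+|11⟩`: `L ≤ 5` on tree contractions, `L(A) = 43/8` (so κ₂ ≥ 43/40).
- Kills: "unentangled ⇒ frame-certified ⇒ classically easy" via adaptive product frames, already at two qubits; the SEP-vs-tree-frame dilation is
  a genuine gap. Escape: none filed (route retired: "dead in every usable form").

### QA-B05 · `ShorLocallyDark.MixedMarginalsDark` (stmt-8592) — REFUTED, misstated · `…Theorems.ShorLocallyDarkMixedMarginalsDark_refuted` · item DROPPED, repaired as `MixedMarginalsDarkR` (stmt-10381)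
- Statement: `∃ c > 0 ∃ n₀ ∀ n ≥ n₀`, all but `≤ 2^{(2−c)n}` pairs `(N,a)` (`N = pq` distinct primes, `2^{n−1} < N < 2ⁿ`, `a` a unit) have every
  reduced-density-matrix entry of Shor's register (control set `S`, work bits `T`, `(|S|+|T|) log n ≤ cn`) within `2^{−|S|}N^{−c}` of the `a`-independent reference.
- Witness: even semiprimes `N = 2q`, odd `a`: `a^x mod N` is always odd, so cell `S = ∅, T = {0}` has entry `0` vs reference `1/2`; Chebyshev's `θ` bounds
  (`Chebyshev.theta_ge`, `theta_le_log4_mul_x`) give `≫ 2^{(2−c)n}` exceptions for every `c`.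
- Kills: the unbalanced-modulus form (E02). Escape: odd / balanced moduli `p, q ≥ N^{1/3}` (`MixedMarginalsDarkR`).

### QA-B06 · [g2] `RegulatorThird.ThirdNotBPP` (stmt-15712, the route's rank-0 TARGET) — REFUTED, misstated · `Summit.QuantumAdvantage.QuantumAdvantage.Theorems.RegulatorThirdThirdNotBPP_refuted` (RegulatorThirdThirdNotBPPRefutation.lean @ b65922813997; refuter-rreview-0816T15-2-0, 2026-08-16T16:44Z) · decl REPLACED at route rev 2 by `ThirdNotBPPR` (stmt-15981); the refuted statement survives only as a file-local notation in the refutation file and in the negatives index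
- Statement: the language THIRD — pairs `⟨bin D, w⟩`, `D > 1` non-square, `w` a prefix of the code of the LEAST triple `(A*, B*, n*)` (key `|A| + |B| + n`, then
  lexicographic) whose class `(A + B·α)/n` lies in `u·K^{×3} ∪ u⁻¹·K^{×3}` for the fundamental unit `u` of `ℚ(√s)` (`s` the squarefree kernel of `D`) — is not
  in `BPP`; the inlined representative clause reads `∃ z : K, (A + B·α)/n = u·z³ ∨ (A + B·α)/n = u⁻¹·z³` with NO condition `z ≠ 0`.
- Witness: `z = 0` makes `(A, B, n) = (0, 0, 1)` a representative for every `D`, with the least possible key `1`; so THIRD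
  `= {⟨bin D, w⟩ : ¬ IsSquare D ∧ 1 < D ∧ w <+: code(0,0,1)} ∈ P ⊆ BPP` (pair / canonicity tests, `⌊√D⌋² < D` by the `natSqrt`/`prodFn`/`ltFn` bricks, finitely
  many prefix tests; all inside the one theorem, no auxiliary declaration).
- Kills: the seven route decls that inlined the cube-class clause without `z ≠ 0` (all re-issued at rev 2: `ThirdNotBPPR` 15981, `OneThirdFP` 15982, `OneThirdRep`
  15983, `ThirdMemBQPOfFP` 15984, `ThirdMemBQP` 15985, …). Pattern E02/E03 (an existential witness clause admitting the zero element). Escape: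
  `∃ z : K, z ≠ 0 ∧ (… ∨ …)` — the witness then misses (`u·z³ ≠ 0`). The repaired target stays hypothesis-type (A03): staff `ThirdMemBQP` / `OneThirdFP` /
  `OneThirdRep`, never the hardness.

---------------------------------------------------------------------------------------------------------------------------------

## Part C — Proved kills, in-tree dequantizations and retired mechanisms (negative knowledge that is not a `¬`-theorem of an open item)

### QA-C01 · Matchgate-magic powers have superpolynomial constant-precision Gaussian rank — `NegApproxGaussRankSuperpoly` (stmt-1245) PROVED (`SpinorFlattening.NegApproxGaussRankSuperpoly_of`)
- `∃ δ ∈ (0,1) ∀ c ∃ t ∀ r ≤ t^c + c ∀ a g, (∀ i, IsGaussian (g i)) → δ² < normSq (magicMPow t − Σ a i • g i)` (proved at `δ = 1/2`, indeed every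
  `δ < 1` along the line; `not_inner_of_one_le` shows `δ < 1` is forced). Kills B02 and every polynomial-Gaussian-rank dequantization through `|M⟩`.
  Sharp one-term form `normSq_magicMPow_sub_smul_gaussian_ge : 1 − 2^{−t} ≤ ‖M^{⊗t} − a·g‖²` (D11).

### QA-C02 · The free-frame road is dead — `NoFreeFrame` (stmt-10731) PROVED ⇒ A16. Open remnants closed `moot`: `CompositeFrameBound` 10730 (D03), `DlogGraphFlat` 10732.

### QA-C03 · Cubic 2-fold Forrelation is classical (unsigned) — `CubicForrelation.CubicForrelationInPrBPP` (stmt-2204) PROVED (`…Theorems.CubicForrelationInPrBPP_proof` = Literature `CubicDequant.cubicKForrelationProblem_two_mem_PromiseBPP'`)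
- `cubicKForrelationProblem 2 ∈ PromiseBPP'` (YES `Φ ≥ 3/5`, NO `|Φ| ≤ 1/100`, `k = 2`, `n` even, both `B₂`-circuits of 𝔽₂-degree ≤ 3): the
  Φ²-estimator (derivative-Walsh tables, exact quadratic Fourier sampling, Chebyshev over 128 blocks, idle-wire guard).
- Further dequantizations landed as negative knowledge (D04, D19, D20): `signedHalfQuadProblem_mem_PromiseBPP'` — SIGNED 2-fold Forrelation with
  ONE quadratic side (other arbitrary) is in `PromiseBPP'`; `signedDegTwoProblem_mem_PromiseBPP'` — signed quadratic/quadratic is classical;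
  `signed_slice_defeats_table_deciders` — no decider seeing only `(T_f, T_g)` separates the signed promise; `forrelation_eq_sign_mul_sign_bias`,
  `forrelation_mul_cosetBias_eq` — on the exact slice the sign is `(-1)^{g(0)}·sgn bias(f)` and, GIVEN a normality flat, one evaluation.
- Kills: unsigned cubic `k = 2` Forrelation as an advantage witness; signed versions unless BOTH sides have degree exactly 3; table-based attacks
  on the sign. Escape: the SIGN with both sides cubic (`SignedExactCubicForrelationNotPrBPP` 13932, open) — whose cheapest refuter is an `FP`
  M-subspace finder (`PairFinderExact`, D21); `k = 3` (Aaronson–Ambainis §6) if the `k = 2` line breaks (`not_mem_cubicKForrelationProblem_imp_separation`: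
  every rung outside `PromiseBPP'` is a `PromiseBQP ⊄ PromiseBPP'` separation, A03-strength).

### QA-C04 · `DeqThesis`/`FFThesis` (`BQP ⊆ BPP`, stmt-0242): a kill IS the summit; uniformity and the error gap are load-bearing — see D07 (the single most consequential negative file for ¬side planners: `exists_tfree_basis_family_deciding_non_BPP`).

### QA-C05 · White-box lift for ONE slice — `SignedExactSliceIsLift` (stmt-14830) PROVED (`signedExactSliceIsLift_holds`): `NearExactIsExact → slice ∈ promiseLift BQP` for the signed exact cubic slice. Shows what an A08-escaping lift looks like (degree projection + AND-power amplification are load-bearing: D22).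

### QA-C06 · `PlLift` (stmt-0250) cannot be refuted short of the summit and cannot be proved by monotonicity — work file `Cruxes/PlLift/Disproof.lean` (sorry-free theorems; no `Negative/` dir yet): `not_plLift_iff : ¬ PlLift ↔ (¬ QuantumAdvantage ∧ ¬ (PromiseBQP ⊆ PromiseBPP'))`, `plLift_iff_collapse_iff`, `promise_collapse_imp` (converse lift is a theorem), `not_semanticLiftSchema` + `plLift_iff_instance` (the abstract `LangOf ⊆ → PromOf ⊆` schema is FALSE on a 3-point model), `exists_not_plLiftRel_of` (glue to A08). Kills: refuter seats on 0250 (verdict: kill = summit); "by monotonicity" proofs.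

### QA-C07 · Black-box SVL needs `min(T, √2^m)` quantum queries — `WhiteBoxWalk.WbwVerifiableLineNoSpeedup` (stmt-2239) PROVED (`…Theorems.WbwVerifiableLineNoSpeedup.CycleSurgery.WbwVerifiableLineNoSpeedup_of`, 2026-08-16; adversary files D25): `∃ c > 0 ∀ m T, 2 ≤ m → 1 ≤ T → T+1 ≤ 2^{m−1} → c·min (T+1) √(2^m)/m ≤ Q_{1/3}(svlPromise m T, svlSinkBit m T)` (`svlAdversarySmallT`: κ = 1/1728 for `8T ≤ 2^m`, Ambainis weighted adversary `weightedAdversaryBound_holds`, padding monotonicity). Kills: "verifiable glued-trees lines are quantumly easy in the black box" — the positive engine of WhiteBoxWalk is a theorem; refuted strengthenings: walk-branch-only (`not_walkBranchOnly`), Grover-branch-only (`not_groverBranchOnly`); quantifier-swapped weakening is TRUE (`pointwise_bound`), so no finite refutation exists.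

### QA-C08 · Conditional kill of the LU-dressed free-frame road — `SymplecticPurityDeqThesisRoadKill.roadLFF_false_of_coreBalancedFlat` (Theorems, stmt-0242 line `Sketch`): `H_LFF` (a layer of one-qubit unitaries + semantic Clifford frame with all cuts of purity `≥ 1/poly`) is FALSE for the scratch-free cube family MODULO the open stub `stub_coreBalancedFlat` (doubly-balanced locally rotated Pauli strings); four-way regime split `cubeLocallyFlat_of_core` (light/one-sided/unbalanced stubs landed p87798, p87072, p87356, p91949).

### QA-C09 · `IQ3 ∈ BPP → SQUAREFREES ∈ BPP` — `ArithStatLadderIqThreeNotPPolyUniformFloor.sqfree_mem_BPP_of_iqThree_mem_BPP` (unconditional; Nagell reduction `SQUAREFREES ≤ IQ3`): the UNIFORM refutation floor of the binder `IqThreeNotBPP` (14864) — a `BPP` algorithm for `3 ∣ h(−d)` on fundamental discriminants yields a `BPP` squarefreeness test (Adleman–McCurley open problem O8); conversely `iqThreeNotBPP_of_sqfreeNotBPP : SQUAREFREES ∉ BPP → IqThreeNotBPP`. Kills: cheap refutations of 14864/2422 (they would solve O8). Companion floors: `primeIqThreeLang_mem_BPP_of_not` (D14), `primeIqThreeLang_mem_PPoly_of_not`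 (D15).

### QA-C10 · Separation-strength stubs (do not staff as proof targets): `CubicForrelationSignedCubicForrelationNotPrBPPTerminalHardStrength.terminalHard_imp_P_ne_PP` (line `Sketch` of stmt-13931: hardness of the kernel-free terminal sub-family + `SignedCubicForrelationMemPromiseBQP` ⇒ `P ≠ PP`); `Cruxes/…/Disproof.lean §1 crux_imp_P_ne_PP` for X itself; D13 `BQP_ne_PSPACE_of_not_iqThreeMemBQP`; D11 `P_ne_PSPACE_of_not_GaussRankPolyImpliesPPoly`; D15 `PSPACE_not_subset_PPoly_of`; D07 `P_ne_PSPACE_of_not_ffThesis`. Pattern E05.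

### QA-C11 · `stub_structure` ⇒ r5: `CubicForrelationSignedCubicForrelationInPrBPPStructureNeedsDillon` / `…NeedsR5` (stmt-13933 line `polar-radical-seeds`): the structural conjecture "every cubic pair with `|Φ| ≥ 3/5` has a ⊕-closed `V` of logarithmic M-defect on whose cosets one function is affine" IMPLIES `ExactPairsMaioranaMcFarland` (2205) outright (`ExactPairsMaioranaMcFarland_of_structure`; M-defect additive under direct sums, `exists_power_beyond_log_defect`): one exact cubic pair with a non-Dillon side beats every logarithmic defect budget. Cheapest falsifier of both = one cubic bent function outside completed MM with CUBIC dual (none known; PP20's `h^10_4` has quartic dual, D09).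

### QA-C12 · Retired / closed routes as negative knowledge (route files kept with CLOSED headers; `ledger route show <id>`)
- CLOSED refuted: SeparableFrames (B04), SpinorFlattening (B02).
- [g2] DONE (not closed, nothing to staff): AreaUncertainty (rev 1; its X = `GraphHSPHard` 2621 is verbatim BochnerSampling's hypothesis-type target — a second
  thesis on a shared decl). DRAFT in the D-0033 tribunal (not served to provers until PASS): CubicForrelation (rev 18; conjunct split declared — ATTACKED
  `NearExactIsExact` 14043, RESIDUAL `SignedExactCubicForrelationNotPrBPP` 13932, `SignedExactSliceIsLift` 14830 proved), WhiteBoxWalk (rev 11; summit-strength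
  repair on `WbwPromiseLift`, `WbwCryptoPremise` 18372 unvetted, `WbwVerifiableLineNoSpeedup` 2239 proved → `aside`), HankelLift (rev 0, new 2026-08-17).
  BROKEN → REPAIRED within the day: RegulatorThird (B06; rev 2–3). CompactnessLift: `CompactnessPrinciple` 15270 proved-as-typed (void, C13), `LanguageLadder`
  15271 → `aside` (summit-strength), re-typed cruxes `UniformExponentLift` 18126 / `LanguageLadderR` 18127, glue certified 2026-08-17T13:41Z.
- CLOSED retire-with-barriers: SymplecticPurity (A16; "let the X pair go").
- CLOSED not-a-thesis (D-0027 §2.1 audit 2026-08-15 — assemblies concluding an intermediate statement, not the summit; ideas may be re-opened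
  ONLY with a `closes` reaching `QuantumAdvantage`/its negation): CliffordParallel (`ThresholdHypothesisKill`: poly stabilizer rank ⇒ `BQP ⊆ TC⁰/poly`,
  `PP ⊆ NP`-type collapses), CodeFlattening (`RobustFlatteningWitness` for stabilizer rank of `|T⟩^{⊗n}`), FermionicMagic (`FermiSeaApproxRank`),
  GenericAngle (`ExactRankSuperpoly` ⇔ Dicke-basis stabilizer span), MagicSpectrum (Strassen asymptotic spectrum of magic), MomentTransport
  (Pauli-moment relaxations need `2^{Ω(n)}` on a flat cubic phase layer — an ENGINE/BARRIER route; its content, if wanted, belongs in this catalogue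
  as a Literature entry, not as a route).
- CLOSED route-choice retire: InverterDequantization (conditional bridge on `MCSPMemBPP` = `MCSP ∈ BPP`, believed FALSE by opener, reviewer, grounder —
  a bridge on a disbelieved condition is not a route).
- CLOSED exhausted WITH RESULT: Shor (standalone conditional bridge `FACT ∉ BPP ⇒ summit`; provable content fully banked: `FACT_mem_BQP_holds`,
  `factoring_mem_FBQP_holds`, search-to-decision). CLOSED superseded by Shor: AvgCase (`AvgThesis`), CircuitLB (`ClbThesis : ¬ BQP ⊆ P/poly`,
  conditional-complete via Shor∘Adleman, A04 applies).
- Standing items left OPEN but orphaned: `DeqNegStabrankSuperpoly` 0247 (Dequantize crux; three retired engine routes targeted it), `ExactRankSuperpoly`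
  1794 (ModularRank crux). A new engine for them must be filed INSIDE a deciding route (thin-route rules) or as a crux line, not as a route.

### QA-C13 · [g2] `CompactnessLift.CompactnessPrinciple` (stmt-15270) PROVED AS TYPED by coin padding — hence VOID; `LanguageLadder` (stmt-15271) AS TYPED is the summit in the quadratic window (kind → `aside`) · `Theorems/CompactnessLiftCompactnessPrinciple{,InstMap,Preimage,SquareClock,TruncRun}.lean` (`CompactnessLiftPadding.paddingCollapse`, `compactnessPrinciple_proof`), `Theorems/CompactnessLiftLanguageLadderSummitStrength.lean`, `CompactnessLiftPlImpliesCp.lean`, `CompactnessLiftQuadSubsetBQP.lean`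
- `paddingCollapse : ∃ c₀, BPP ⊆ bp (DTIME (fun n => n ^ c₀))` (UNCONDITIONAL; square-clocked universal machine + coin truncation — Arora–Barak Thm 1.9 / §1.4.1,
  Aaronson–van Melkebeek 2011 §3.3): in the tree's operator `bp` the coin string has length `p |x|` for an ARBITRARY polynomial `p` and the inner `DTIME` machine
  is clocked on the padded pair `⟨x, y⟩`, so coins are free padding and the typed family `c ↦ bp (DTIME (·^c))` takes exactly TWO values — `∅` at `c = 0`
  (`bp_DTIME_pow_zero_eq_empty`, D26) and `BPP` at every `c ≥ 1` (`exists_bp_DTIME_pow_eq_BPP`; work file `bp_DTIME_pow_eq_ite`). Hence the filed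
  `CompactnessPrinciple` ("`BQP ⊆ BPP → ∃ c, QuadQ ⊆ bp (DTIME n^c)`", `QuadQ = BQTime (·^2)`) is the triviality `QuadQ ⊆ BQP` (`compactnessPrinciple_proof`,
  `quadQ_subset_BQP`; `PlImpliesCp` 15273 and `QuadSubsetBQP` 15275 proved alongside) — closed `proved`, content nil; the refuters' reading had been
  `compactnessPrinciple_of_H1` / `compactnessPrinciple_of_nonuniform` (the NON-uniform statement already gives the crux).
- `LanguageLadder := ∀ c, ∃ L ∈ BQTime (·^2), L ∉ bp (DTIME (·^c))` is consequently EXACTLY `¬ (BQTime (·^2) ⊆ BPP)` (`languageLadder_iff_not_BQTime_two_subset_BPP`),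
  implies the summit outright (`quantumAdvantage_of_languageLadder`), its `∀ c` is decorative (`languageLadder_iff_exists_forall`), and modulo the route's own
  padding item `SummitGivesLadder` 15274 it is EQUIVALENT to the summit (`languageLadder_iff_quantumAdvantage_of_summitGivesLadder`, `summitGivesLadder_iff`); a
  refutation is exactly a full dequantization of quadratic-time-uniform Clifford+T deciders (`not_languageLadder_iff_BQTime_two_subset_BPP`). Verdict `misstated`
  (kernel-certified costume, nine readings). The route re-typed both items over honest `BPTime`: cruxes `UniformExponentLift` 18126 (r2: `BQTime(n²) ⊆ BPP` ⇒ ONE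
  classical exponent) and `LanguageLadderR := ∀ c, ∃ L ∈ BQTime (·^2), L ∉ BPTime (·^c)` 18127 (r6, hypothesis-type: rungs `c ≥ 4` are padded Shor, even rung 1
  is open unconditionally — no `BPTIME` hierarchy —; D27).
- Kills: every fixed-exponent statement typed through `bp (DTIME …)` / `bp (TimeClass …)` (pattern E09); "compactness" / union-theorem lifts whose exponent
  bookkeeping lives inside `bp`. Escape: type `BPTime t` (coins counted by the clock) and keep the additive slack (D27); the INTENDED principle CP′ is
  irrefutable short of `¬S` (`not_cp'_imp_collapse : ¬ CP′ → BQP ⊆ BPP`, D26), so it is staffed prover-side only, refuters relativize (`OracleDichotomy` 15277).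

### QA-C14 · [g2] Apex strengths made theorems — what PROVING the open `∉ P/poly` / `∉ BPP` apexes would also prove (ArithStatLadder line files `Theorems/ArithStatLadderIqThreeNotPPolyApex{NP,BQP,MinFac,Factoring,Split,AC0,AC0IqTwo}.lean`, `…IqThreeNotPPolyMem{PSPACE,PSharpP}.lean`, `…ClassNumberSharpP.lean`; MobiusLadder `Theorems/MobiusLadderLiouvilleNotPPolyStrength.lean`)
- `IqThreeNotPPoly` 2422 (line `Sketch` = squarefree-filter domination, complete modulo its apex `stub_sqfreeNotPPoly : SQF ∉ P/poly`, `SQF = bin {m | Squarefree m}`):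
  `iqThreeNotPPoly_iff_squarefree_or_promise` (X ↔ `SQF ∉ P/poly` ∨ the factoring-free PROMISE core `PromiseIqThreeNotPPoly` of the disprover), `squarefree_compl_mem_NP` /
  `squarefree_mem_coNP` ⇒ the apex implies `NP ⊄ P/poly` (Karp–Lipton strength; A03/A04/A19 apply to it as to the crux), `squarefree_polyTimeTuringReducible_FACT` +
  `exists_minFac_adPres` + `exists_squarefree_adPres` ⇒ `SQF ∉ P/poly → FACT ∉ P/poly` and `SQF ∉ BPP → FACT ∉ BPP` (the apexes sit ABOVE the factoring theses
  `ClbFactNotPpoly` / `ShorThesis` of the closed routes CircuitLB / Shor), `squarefree_mem_BQP` (UNCONDITIONAL, via `SQF ≤ₚ FUND`), `FUND ∈ P/poly ↔ SQF ∈ P/poly`,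
  `iqThreeLang_mem_PSharpP` (one `#P` query; `classNumber_negVal_mem_SharpP`) and `… ∈ PSPACE` (IQ3 is an explicit `P^{#P}` language), `squarefree_not_mem_AC0`,
  `fund_not_mem_AC0` (the apex's unconditional `AC⁰` rung: Bernasconi–Damm–Shparlinski average sensitivity + LMN / Boppana).
- `LiouvilleNotPPoly` 1389 (MobiusLadder rank-0 apex): `L_λ = bin {N : λ(N) = −1}` and its twin are in `NP ∩ coNP` (factorisation WITH multiplicity + Pratt
  certificates, a parity fold brick; soundness = unique factorisation), hence the crux implies `NP ⊄ P/poly`, `P ≠ NP` — the summit `PneNP` with `L_λ` as Cook's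
  witness (`pneNP_of_liouvilleNotPPoly`). Pattern E05 at its sharpest: MobiusLadder's apex is a `P ≠ NP` proof obligation (Karp–Lipton strength once promoted);
  staff its rungs (1391–1393) and membership, never the apex; the apex of its line `SketchIdeator2` (`stub_algRootSignHard`) inherits the same status.
- Kills: seats trying to PROVE these apexes outright; equally "cheap" refutations (C09: a `BPP` / `P/poly` algorithm for `IQ3` or `SQF` solves Adleman–McCurley O8 /
  puts a factoring-complete-under-Turing-reductions language family in `P/poly`). Both apexes are hypothesis-type in the A03 sense.

### QA-C15 · [g2] Conjecture obligations named Summits-side (`@[conjecture] def`, used only as hypotheses; never Literature facts) — `Theorems/PhiHidingThree.lean` (+ `PhiHidingThreeInfinitelyOften.lean`, `PhiHidingThreePresentations.lean`), precedent `Theorems/FactoringAssumption.lean`; `Theorems/LinnikCubicClassGroupsPureCubicClassNumberHardHonda25.lean`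
- `PhiHidingThree` — worst-case decisional Φ-hiding for the FIXED exponent `e = 3` against uniform PPT adversaries, on squarefree semiprimes `N = pq ≡ 1 (mod 9)`
  outside `p ≡ q ≡ 8 (mod 9)`; `phiHidingThree_iff_stub` identifies it with the last stub `stub_phiHiding3` of `PureCubicClassNumberHard` 11826 (LinnikCubicClassGroups
  line `Sketch`, honda-leak arm), and `…Honda25.lean` removes the class-field-theory leaf (Honda's criterion on the promise family is now a tree theorem:
  `Literature` `Honda1971.three_dvd_classNumber_of_mod_three_eq_one` + the inert case; `three_dvd_classNumber_iff_of_promise`), so `PureCubicClassNumberHard` follows from Φ-hiding(3) ALONE. Negative reading: the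
  rank-0 target of LinnikCubicClassGroups is now openly CONDITIONAL on a named cryptographic conjecture — refuting the crux classically = breaking Φ-hiding(3); A03
  applies (hardness of a `BQP`-computable quantity), A20's question applies to any relativizing use.
- Rule recorded (gate ruling `literature.conjecture`): an unproven conjecture a line leans on is a `@[conjecture] def` under `Summits/<S>/<Sub>/Theorems/` referenced
  by name, or the route is a declared `--conditional-bridge`; a route with an undeclared conjecture leaf stays `draft` (`undeclared-conjecture`).

---------------------------------------------------------------------------------------------------------------------------------

## Part D — Crux-level negative lemmas (`Theorems/<Crux>/Negative/*.lean`, sorry-free, importable; work files `Cruxes/<Crux>/Disproof.lean`)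

Convention of the standing disprovers: `X_false_without_H` = "any proof of X must use H" (the variant with H dropped is false); `not_…` =
refuted strengthening/mutation; `…_iff` read-backs; tightness lemmas bound what a proof or refutation can look like. Namespace of each file:
`Summit.QuantumAdvantage.QuantumAdvantage.Theorems.<Crux>.Negative` unless noted (some use the route namespace).

### QA-D01 · `ArithStatLadder.AcZeroRung` (stmt-2425, closed `moot`; AC⁰ rung: centred `#Cl₃(−d) − 2` has `o(#𝒟_n)` correlation with every constant-depth poly-size `acBasis` circuit in the digits of `d`) — `AcZeroRung/Negative/{LoadBearing,SizeBasisFund,LadderSets}.lean`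
- Load-bearing: `acZeroRungCentred_false_of_lt_one`/`acZeroRung_false_uncentred` (centring), `centre_unique` + `dyadicMean_of_acZeroRungCentred`
  (`AcZeroRung → DyadicMean 2`: the crux CONTAINS dyadic Davenport–Heilbronn, not a tree theorem; `not_acZeroRung_of_not_dyadicMean_two`),
  `acZeroRung_false_without_size` (poly SIZE is the whole content, already at depth 2: sign-test DNF `exists_circuit_violating`),
  `acZeroRung_false_without_basis` (one arity-`n` gate: a genuine AC⁰ property is needed), `acZeroRung_false_without_pins`, `acZeroRung_false_without_fund`
  (fundamental-discriminant filter; junk witness `junkT`). Ladder: `not_acZeroRung_of_not_digitRung` (contains `DigitRung`, D08).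
  Read-backs: `acZeroRung_iff`, `rung_iff`, `acZeroRung_iff_sets` (set form: `#Cl₃` has mean 2 on every AC⁰-definable set).
- Kills: uncentred/unsized/basis-free variants; "depth/size counting" proofs. Escape: switching-lemma/LMN-type arguments + DH with AC⁰ conditions.
- [g2] Fullbuild repair 2026-08-17: the crux was dropped from ArithStatLadder at rev 3 (closed `moot`), so its statement is now kept verbatim inside
  `AcZeroRung/Negative/LoadBearing.lean` (local decl; `quadFieldThreeTorsion_spec` deduplicated, deprecated alias) — the negative lemmas still elaborate against the
  ledger signature. WeilTwice re-files an `AcZeroRung` SUPPORT (16546, for `#Jac(C)(𝔽_p)[3]`): run this entry's load-bearing list (centring, size, basis, pins,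
  the fundamental filter's analogue) over it before staffing.

### QA-D02 · `ArithStatLadder.AvgFaceBeyondPrior` (stmt-2427, OPEN; `(IQ3, U) ∉ Heur_{1/3}BPP`, `U_n` uniform on n-bit fundamental `−d`) — `AvgFaceBeyondPrior/Negative/{…Necessary,…Often,…Transfer,…Blocks,…Conditioning}.lean`
- `avgFace_iff` (read-back), `avgFaceBeyondPrior_false_without_PPT` (poly time is the whole content), δ-axis: `not_mem_HeurDeltaBPP_anti`,
  `not_mem_HeurDeltaBPP_of_neg`, `avgFaceBeyondPrior_false_at_delta_one`; NECESSARY arithmetic content: `avgFace_imp_exists_level_ge` — for every `N`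
  a level `n ≥ N` with MORE THAN A THIRD of n-bit fundamental `−d` having `3 ∣ h(−d)` (numerically true: PARI j010646 `p_n > 1/3` at `n = 5` and `12 ≤ n ≤ 24`;
  in print not even a positive proportion is known — any proof proves new arithmetic statistics or embeds a certified computation);
  `avgFace_imp_not_mem_BPP` (crux ⇒ `IQ3 ∉ BPP` ⇒ A03 applies to the crux itself); conditioning load-bearing:
  `avgFaceBeyondPrior_false_without_conditioning` (on uniform n-bit integers the `δ = 1/3` face is FALSE: `three_mul_card_fundBlock_le`);
  refutation criterion: `mem_HeurDeltaBPP_of_approx_mem_BPP`, `not_avgFace_of_approx_mem_BPP`, `mem_HeurDeltaBPP_of_density`,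
  `not_avgFace_of_density_le_third`, `not_avgFace_of_eventually_agree`, `not_avgFace_of_mirrorAgreement` (= stub `stub_heurTransfer` of line
  `mirror-unit-signature`, verbatim); `not_avgFace_of_not_summit` (`¬QuantumAdvantage ∧ IqThreeMemBQP → ¬ crux`).
- Kills: unconditioned ensembles; attacks not meeting the 1/3-density criterion; "δ arbitrary" versions. Escape: the conditioned ensemble with `δ` below Cohen–Lenstra's 0.44.

### QA-D03 · `SymplecticPurity.CompositeFrameBound` (stmt-10730, closed `moot`; depth-3 Clifford∘Gaussian∘Clifford frames keep a cut of the cube graph state at purity `≤ 2^{−cn}`) — `CompositeFrameBound/Negative/LoadBearing.lean`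
- `crux_iff` (schema `FrameBound`), `false_without_clifford₁`, `false_without_clifford₂`, `false_without_gaussian` (drop the STRUCTURE of any one
  layer, keep unitarity ⇒ false: that layer may be a disentangler, `exists_unitary_ghat_to_zero`); toolkit `sum_norm_sq_ghat`, `cutPurity_basisState`,
  `exists_field`. Kills: two-layer proofs. Escape: must use all three structure predicates. (The open evasion of A16.)

### QA-D04 · `CubicForrelation.CubicForrelationInPrBPP` (stmt-2204, PROVED, C03) — `CubicForrelationInPrBPP/Negative/{SignedSlice,FlatSign,NoJunk,ClassNontrivial,IdleWireGuardOddK}.lean`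
- `signed_slice_defeats_table_deciders`, `forrelation_mul_bias_eq`, `forrelation_eq_sign_mul_sign_bias`, `W_eq_of_fsum_sq` (rigidity of exact pairs:
  `W_g = (S/2ⁿ) f`), `forrelation_mul_cosetBias_eq` (flat ⇒ one evaluation), `cubicForrelation_promise_nondegenerate` (both sides inhabited,
  disjoint: no junk refutation), `exists_disjoint_not_mem_PromiseBPP'` (the class is proper), `not_mem_cubicKForrelationProblem_imp_separation`
  (every rung outside `PromiseBPP'` separates `PromiseBQP` from `PromiseBPP'`), `idleWireGuard_iff_even` (the idle-wire guard `n ≤ |code| + 1` holds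
  iff `k` is even; FALSE at `k = 1, 3`: `idleWireGuard_false_at_k3` — the `k = 3` restatement must re-derive its guard).

### QA-D05 · `CubicForrelation.CubicStability` (stmt-2202, REFUTED, B01) — `CubicStability/Negative/{P4Witness,P4Facts,WithoutEven}.lean`: the `P₄` facts (`yes_fA_gB`, `sum_w = 160000`, `w_ge`, `negPz_le`, Walsh lemmas `W_eq_of_fsum_eq`, `W_dual`, `two_pow_eq_corr_add`) and `not_cubicStability_without_even` (odd `n`: `(0,0)` on one bit is YES, nothing is exact).

### QA-D06 · `LinnikCubicClassGroups.DegreeOnePrimesEscape` (stmt-11543, OPEN; also ThirdFactorialPincer r5) — `DegreeOnePrimesEscape/Negative/{EscapeCounting,EscapeSign,WithoutProperFalse}.lean` (+ A18)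
- `degreeOnePrimesEscape_false_without_proper`; coset counting `card_le_two_mul_ncard_compl`, `card_le_four_mul_ncard_compl_union` and its
  SHARPNESS `four_mul_ncard_compl_union_eq` (the `h/4` of the exceptional-character case cannot improve by group theory); skeletons
  `crux_ineq_of_classwise_half/_quarter`, `ncard_escapeSet_eq_sum`; sign of the exceptional term: `re_sum_filter_not_mem_nonpos` (a NONTRIVIAL
  exceptional character only enriches escape counts), `sum_filter_not_mem_one` (the only depletion is a real zero of `ζ_K` itself — what Stark 1974 /
  "no quadratic subfield" controls), `escape_mass_half_signed`. Kills: counterexample hunts via nontrivial exceptional characters; dropping properness.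
  Escape: fields without quadratic subfield (the crux's hypothesis) — conditionally proved per route header (Thorner–Zaman + Stark).

### QA-D07 · `DeqThesis`/`FFThesis`/`PPThesis`/`KcThesis`/`ClosureThesis`/`XdcThesis`/`TspThesis` = `BQP ⊆ BPP` (stmt-0242, OPEN; shared by Dequantize, ModularRank, PauliFlat, TwoAdicStationaryPhase, ShorLocallyDark, XorDarkCharacters, RectangleFree; ex SymplecticPurity) — `DeqThesis/Negative/{DeqThesisKillIsSummit,DeqThesisFalseWithoutGap,DeqThesisFalseWithoutUniformity,DeqThesisShorEdge}.lean`
- `not_ffThesis_iff_quantumAdvantage : ¬ FFThesis ↔ QuantumAdvantage` — A KILL IS THE SUMMIT (refuter verdict for 0242: unrefutable short of the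
  problem); `ffThesis_iff_bqpEqBPP`; negative edges with Shor: `deqThesis_false_of_FACT_not_mem_BPP`, `deqThesis_false_of_shorThesis`,
  `shorThesis_false_of_deqThesis` (0231 ⇔ ¬0242 given `FACT_mem_BQP_holds`); consequences of a kill `not_PSPACE_subset_BPP_of_not_ffThesis`,
  `not_PP_subset_BPP_of_not_ffThesis`, `P_ne_PSPACE_of_not_ffThesis` (A03); both relativized directions fail `not_forall_oracle_thesis`,
  `not_forall_oracle_kill` (A01); `ffThesis_iff_BQPRel_zero` (oracle-freeness NOT load-bearing); `deqThesis_kill_profile` (summary).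
- `deqThesis_false_without_gap : ¬ (BQPWith cliffordT (1/2) ⊆ BPP)` — the error bound is load-bearing (ties `Pr = 1/2`: `hadFamily_acceptProbOn`,
  uncountably many languages `not_countable_BQPWith_half` vs `countable_BPP`); `BQPWith_subset_BPP_iff_of_lt_half` (sharp dichotomy at 1/2).
- `deqThesis_false_without_uniformity : ¬ (BQPNonuniform ⊆ BPP)` and **`exists_tfree_basis_family_deciding_non_BPP`** — there is a language OUTSIDE
  `BPP` decided EXACTLY by an oracle-free, poly-size, `T`-FREE (pure Clifford, `tCount = 0`), basis-to-basis family (bond dimension 1, stabilizer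
  rank 1, one Pauli pattern): STATE-COMPLEXITY ROADS NEED UNIFORMITY — no hypothesis bounding entanglement / magic / stabilizer or Gaussian rank /
  Pauli spectrum / purity of the STATES of a family implies `BPP` by itself; every dequantization must consume the uniform DESCRIPTION map
  (`lengthFamily`, `lengthSet_mem_BQPNonuniform`, `exists_lengthSet_not_mem_BPP`).
- Kills: refuter seats on 0242; gap-free or non-uniform strengthenings; every ¬side argument of the form "the states along the family have
  resource ≤ poly ⇒ classical" that does not thread uniformity (PauliFlat `PPTruncationCollapse` 1992, XorDarkCharacters, RectangleFree
  `SchmidtBoundedCollapse` 9749, ShorLocallyDark, Dequantize `DeqGottesmanKnillUniform` 0245 — the latter is exactly the uniform thread: keep it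
  load-bearing). Escape: none (these are constraints on proofs of X).

### QA-D08 · `ArithStatLadder.DigitRung` (stmt-2423 closed `moot`; restated as support `DigitRung` stmt-15008, OPEN; Davenport–Heilbronn on every binary-digit half) — `DigitRung/Negative/{Reduction,WalshAndIndependence,NoTwoAdicBias,TwoAdicDigitBalance,HessianDisc}.lean`
- `digitRung_iff_canonical` (the `∀ t` pinned statistic is bookkeeping: one statement at `quadFieldThreeTorsion`), `digitRung_false_without_pins`,
  `digitRung_implies_dyadicMeanTwo` (contains dyadic DH; tree has it only as named fact `bst_threeTorsion_mean`), `not_digitRung_iff` (shape of a disproof);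
  `concl_iff_total_and_walsh` (⇔ dyadic mean + weight-one digital Walsh correlations `o(#𝒟_n)`), `exists_subset_large_dev` (unstructured test sets fail
  maximally: digit STRUCTURE is essential), `gcd_six_mul_two_pow_ne_one` (Taniguchi–Thorne AP fact needs `gcd(6a,m) = 1`, NEVER true for `m = 2^{j+1}`:
  the low-digit end is not in the tree even as a fact), `model_ends_hold_middle_fails` (the printed ends cannot be interpolated into the middle band);
  no 2-adic counterexample: `card_cubicDisc_eq_mul_unit_pow_six`, `pow_six_odd_mod_64`, `card_cubicDisc_eq_add_two_pow` (every binary digit of a cubic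
  discriminant beyond the square class is EXACTLY 2-adically fair, any twist-stable family), `det_hessCubicDisc = 3888·Disc²` (non-degenerate phase).
- Kills: refutation by 2-adic density bias (none exists); proofs from the two printed ends alone; progression facts with `gcd` conditions.
  Escape: the open middle band `(5/43)n < j < (2/3)n` needs a genuinely new equidistribution input (Hessian/Poisson upper band idea).

### QA-D09 · `CubicForrelation.ExactPairsMaioranaMcFarland` (stmt-2205, OPEN support r5; exact cubic pairs are completed Maiorana–McFarland) — `ExactPairsMaioranaMcFarland/Negative/{DillonCertificate,H104Pair,TwoAdicMutations,GStarWitness}.lean` (computational: `native_decide` certificates)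
- Dillon machinery `mm_family`, `count_ge_of_MM`, `not_MM_of_bigCountC_lt` (10-variable MM#-membership refuter); the Polujan–Pott pair `g4 = h^10_4`
  (cubic bent, NOT MM#), `f4` its QUARTIC dual, `forrelation_f4_g4 = 1`, `W_g4`, `W_f4`, `W_eq_of_forrelation_eq_one` (`Φ = 1 ⇒ W_g = 2^m(−1)^f`, all `m`);
  line `two-adic-local-nongeneric` mutations: `localToGlobal_false_without_flats` (rind `h^10_4` = 4 < 5), `localToGlobal_false_without_gCubic_dualForm`,
  `localToGlobal_false_without_gCubic_of_twoAdicFlats`, `twoAdicFlats_false_without_fCubic` (weight-22 flat), `dillonNormalForm_false_without_bent`;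
  `gStar` (cubic bent, quartic dual, rind 5, ind 4: `singular_gStar`, `gStar_not_dillon`, `forrelation_dStar_gStar = 1`) ⇒ `defectVanishing_false_without_fCubic`.
- Kills: every stub that forgets "the DUAL is cubic" or "g is cubic"; T-singular ⇒ Dillon without cubicity. Cheapest falsifier of the crux (and of
  C11's `stub_structure`): one cubic bent function outside MM# with CUBIC dual — unknown in print.

### QA-D10 · `SpinorFlattening.FlatteningBoundRobust` (stmt-1246, closed `moot`; `r·D_K(4t) < C(t,K)·8^K ⇒ 1 ≤ C(8t,K)·‖M^{⊗t} − Σ aᵢgᵢ‖²`) — `FlatteningBoundRobust/Negative/{LoadBearing,DictionaryRigidity,AnnihilatorCount}.lean`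
- `flatteningBoundRobust_iff_named`, `magicMPow_eq_sum_blockStrings` (`χ_G(M^{⊗t}) ≤ 2^t`), load-bearing `…_false_without_count`, `…_false_with_le`
  (strict count sharp), `…_false_without_gauss`, `…_false_without_linIndep`, not load-bearing `…_imp_withoutNonzero`; consistency
  `…_imp_count_le_two_pow`; tightness `…_tight_r0`, `massBound_attained_t1`, `not_better_than_massBound_t1`, `not_without_binomial_factor_t1`,
  `gaussian_decomposition_two_terms_t1`, `calibration_t2`; dictionary rigidity `linComb_anticomm`, `annihilators_orthogonal`, `card_annihilators_le`
  (≤ n independent annihilators: isotropic subspaces), `no_overcomplete_annihilators` (the `n+1` dictionary is EMPTY — a mistyped crux would be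
  vacuous), `flatteningBoundRobust_false_with_four_fewer_annihilators` (`n − 4` annihilators do NOT suffice), `flatteningBoundRobust_false_with_deficiency_pred`
  (`D_K` sharp as a constant). Kills: weakened dictionaries, improved constants. (Crux moot after B02; lemmas reusable for any Gaussian-rank statement.)

### QA-D11 · `SpinorFlattening.GaussRankPolyImpliesPPoly` (stmt-1247, closed `moot`; `GaussRankPolyThesis → BQP ⊆ PPoly`) — `GaussRankPolyImpliesPPoly/Negative/{RefutationShape,ExponentialCoefficients,MajoranaAction,MajoranaCAR,QuadraticRelations,CornerLemma,GaussianFidelity}.lean`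
- `GaussRankPolyThesis_false_of_negApprox` (the designed kill wiring, used by B02), `not_not_GaussRankPolyImpliesPPoly_of_negApprox` (given the kill
  the crux holds ex falso), a refutation would prove `BQP ⊄ P/poly`, `PP ⊄ P/poly`, `PSPACE ⊄ P/poly`, `P ≠ PSPACE` (`…_of_not_GaussRankPolyImpliesPPoly`);
  `not_coefReductionSchema` (no dictionary-free coefficient reduction); REUSABLE POSITIVE CONTENT proved from the annihilator definition alone:
  `isGaussian_quadRel` (Cartan/Plücker quadratic relations), `corner_lemma`, `magicMPow_overlap_le`, **`magicPowFidelityBound_holds`**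
  (`F_𝒢(M^{⊗t}) ≤ 2^{−t}`, Cudby–Strelchuk Lemma 3, new proof), `not_polyCoeffThesis` (poly-coefficient Gaussian-rank thesis FALSE unconditionally),
  `normSq_magicMPow_sub_smul_gaussian_ge`, `majorana_bilinear_bound`, `overlap_bound_of_annihilator`, `gaussian_overlap_sq_le_half_of_cov`
  (vanishing covariance ⇒ Gaussian fidelity ≤ 1/2), `one_sub_le_sqrt_mul_sum_norm` (ℓ¹ extent lower bound).

### QA-D12 · `SpinorFlattening.GaussRankTwoCopies` (stmt-1248, closed `moot`; `χ_G(M⊗M) ≥ 4`, Cudby–Strelchuk conjecture) — `GaussRankTwoCopies/Negative/{TightFour,Annihilators,AnnihilatorRows}.lean`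
- `gaussRankTwoCopies_tight_four` (`χ_G(M⊗M) ≤ 4`: the 3 of the crux cannot be raised), `…_false_without_gaussianity`, `…_false_without_linearIndependence`,
  `gaussianRank_not_multiplicative` (`|+⟩⊗|+⟩` has rank ≤ 2 < 2·2: PARITY of `M` is needed), `magicMPow_two_annihilator_eq_zero` (`M⊗M` has trivial
  annihilator), `magicMPow_two_not_isGaussian`, `gaussRankTwoCopies_false_with_four_annihilators` (sharp threshold: 4 rows per term not enough; ≥ 5 of 8
  needed), `gaussRankTwoCopies_oneTerm_free`, `no_nine_annihilating_rows`, `card_annihilating_rows_le`, `mem_span_rows_of_annihilates` /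
  `IsGaussian.exists_annihilator_basis` (annihilator maximality = Lagrangian), `magicM_annihilator_eq_zero`, `magicM_not_isGaussian`.

### QA-D13 · `ArithStatLadder.IqThreeMemBQP` (stmt-2424, OPEN; `IQ3 ∈ BQP`) — `IqThreeMemBQP/Negative/{RefutationCost,SearchOutputPrefix}.lean`
- `iqThreeMemBQP_iff`; small models `classNumber_neg_twentythree = 3`, `twentythree_mem`, `three_not_mem`, `nil_not_mem`, `lang_ne_zero`, `lang_ne_univ`
  (no trivial-language shortcut); COST OF A REFUTATION: `not_mem_BPP_of_not_iqThreeMemBQP`, `not_mem_P_of_…`, `BQP_ne_PSPACE_of_…`, `P_ne_PSPACE_of_…`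
  (given folklore `IQ3 ∈ PSPACE`) — unrefutable short of class separations (E05); GLUE TRAP: `encodeNat_one_isPrefix_encodeNat_three`,
  `iqThreeMemBQP_hallgrenFact_collapse`, `iqThreeMemBQP_hallgrenFact_underdetermines_threeDvd` — the vendored Hallgren fact writes `bin h(−d)` as a BARE
  PREFIX, which does not determine `3 ∣ h` (`bin 1 <+: bin 3`); fix: self-delimited output `iqThreeMemBQP_hallgrenFact_of_delim`,
  `iqThreeMemBQP_threeDvdBit_qsolvable_of_delim` (then `GRH → IQ3 ∈ BQP` goes through). Pattern E06.

### QA-D14 · `ArithStatLadder.IqThreeNotBPP` (stmt-14864, OPEN binder; `IQ3 ∉ BPP`) — `IqThreeNotBPP/Negative/{IqThreeNotBPPNaivePredictors,IqThreeNotBPPPrimeCore}.lean`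
- Naive `ℓ = 3` genus theories fail (kernel `decide` on class numbers): `threeDvd_classNumber_not_periodic_on_primes` (no period `m ≤ 24`),
  `threeDvd_classNumber_not_periodic_structured` (72,108,216,360,504), `threeDvd_classNumber_not_function_of_characters` (139 vs 19); prime core:
  `inter_mem_BPP_of_mem_P`, `primeIqThreeLang_mem_BPP_of_not` (a refutation decides `3 ∣ h(−p)` on PRIMES in BPP — the class-number conjunct alone is
  load-bearing; contrapositively hardness of the factoring-free prime core suffices). With C09: refutation floor = squarefreeness in BPP.

### QA-D15 · `ArithStatLadder.IqThreeNotPPoly` (stmt-2422, OPEN apex; `IQ3 ∉ P/poly`) — `IqThreeNotPPoly/Negative/{RefutationShape,Strengthenings,GenusTwoParity}.lean`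
- `iqThreeNotPPoly_iff`, `not_iqThreeNotPPoly_iff_exists` (a refutation = explicit poly-size `B₂` family for `3 ∣ h(−d)`; not in print, best `L(1/2)` under GRH);
  cost of the positive side: `not_mem_BPP_of`, `not_mem_P_of`, `PSPACE_not_subset_PPoly_of` (E05), `no_naturalProof_iqThree` (A04 instance);
  `primeIqThreeLang_mem_PPoly_of_not` (prime core); refuted strengthening `iqThree_mem_SIZE_lupanovBound` (every language is in `SIZE(lupanov)`;
  mind `SIZE_eq_empty_of_apply_zero`, E03); refuted mutation `iqOne_mem_PPoly` (`h = 1` language is finite ⇒ in `P/poly`, class-number-one theorem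
  PROVED in tree), `mem_PPoly_of_finite`; `ℓ = 2` mutation via genus theory: `two_dvd_classNumber_iff_not` (`2 ∣ h(−d) ↔ d ∉ {4,8} ∧ d` not prime),
  `iqTwoSet_eq`, `fundSet_eq` (so `IQ2 ∉ P/poly ↔ bin{fundamental} ∉ P/poly` — squarefreeness again).

### QA-D16 · `CubicForrelation.NearExactIsExact` (stmt-14043, OPEN r2; `∃ θ < 1`, cubic pairs with `Φ > θ` are exact) — `NearExactIsExact/Negative/{FifteenSixteenths,SmallCasesWalsh,SmallCasesAnf}.lean`
- `forrelation_f16_g16 = 15/16` — explicit cubic pair on 16 bits (triangular BIQUADRATIC permutation `piV`, `g16 = y′·π(y″)` MM cubic bent with degree-5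
  dual, `f16` its cubic truncation off a codimension-5 flat; seat files `jobs/biquad/verify.py`): `not_nearExact_at_seven_eighths` (the conjectured sharp
  `θ = 7/8` is FALSE), `not_nearExact_at_of_lt`, `nearExactIsExact_iff_ge` (any admissible θ ∈ [15/16, 1)). Small cases certified positively:
  `isolation_of_transform`/`checkT_sound` (`7/8 < Φ ⇒ Φ = 1` for `n = m+m`, `1 ≤ m ≤ 4`, from bentness-or-capacity). Companion (D22):
  `stubV_p0_ge_kasamiTokura` (`p₀ ≥ 1 − (15/64)³`; with 15/16: `≥ 1 − (63/1024)³`, `andPower_copies_ge_52`, indeed `K ≥ 2863`).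
- Kills: θ = 7/8 and every θ < 15/16 (E01: hand-picked thresholds); biquadratic-permutation searches may push θ further — the crux should stay `∃ θ < 1`
  or move to the `1 − n^{−c}` isolation form named in the route's repair menu.
- [g2] New files `NearExactIsExact/Negative/{ValueWitnesses,SmallCasesClasses,SmallCases}.lean` (certified-compute seat, 2026-08-16; in-tree `native_decide`
  checkers `fsumL` / fast Walsh `wal` / `certify`, `computational`): VALUE WITNESSES `forrelation_f8_g8 = 13/16` (the `𝔽₄`-pencil cubic pair, `n = 8`) and
  `forrelation_fT_gT = 7/8` (the `T`-family pair, `n = 10`: the conjectured threshold is ATTAINED by a NON-exact cubic pair), hence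
  `not_isolation_below_seven_eighths_ten`, `not_isolation_below_thirteen_sixteenths_eight`, `nearExactIsExact_iff_ge_seven_eighths` (any admissible `θ ≥ 7/8`;
  with `FifteenSixteenths`: `≥ 15/16`); SMALL CASES CERTIFIED `nearExact78_le_six` (`Φ > 7/8 ⇒ Φ = 1` for every even `n ≤ 6`: Hou's six `GL(6,2)`-orbits of
  cubic forms, BFS closure `2^20`, non-bent capacity maximum `55/64 < 7/8`; `certify_three/two/one`, `certify_sound`, `qc_all`), `nearExactIsExact_iff_from_eight`
  (the crux is decided from `n = 8` on). Small-`n` profile of the isolating threshold: `7/8` works for `n ≤ 6`, fails at `n = 10`; `15/16` is needed from `n = 16`.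
  Route status [g2]: CubicForrelation is `draft` in the tribunal with the declared conjunct split — ATTACKED `NearExactIsExact` (bc5 witness `ar_rankTwoCeiling`),
  RESIDUAL `SignedExactCubicForrelationNotPrBPP` 13932; strategist census `Cruxes/NearExactIsExact/STRATEGY-CENSUS.md` (2026-08-17).

### QA-D17 · `SpinorFlattening.NegApproxGaussRankSuperpoly` (stmt-1245, PROVED, C01) — `NegApproxGaussRankSuperpoly/Negative/{LoadBearing,StubSimplifications}.lean`
- `crux_iff_named`, `magicMPow_eq_sum_basis`, `magicMPow_one_eq` (`χ_G(M) ≤ 2`), load-bearing `false_without_rankBound`, `…_gaussianity`,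
  `…_linearIndependence`, `…_annihilation`; tightness `not_inner_of_one_le` (`δ < 1` forced; "every δ < 1" is best possible), `not_atDeltaOne`,
  `no_witness_t_zero`, `no_witness_t_one`, `not_uniformT` (`∃ t ∀ c` false), `not_allPosT` (`∀ c ∀ t > 0` false; any uniform-in-t version needs `t ≥ t₀(c)`);
  `not_deficiency_topDegreeOnly` (cannot replace `D_K(n)` by `C(n,K)`: repeated letters in Majorana WORDS lower the degree).

### QA-D18 · `LinnikCubicClassGroups.PureCubicClassNumberHard` (stmt-11826, OPEN rank-0 hypothesis-type; no PPT prints the `2|x|+8` low bits of `h(ℚ(∛m))`) — `PureCubicClassNumberHard/Negative/{WellPosed,InfinitelyOften}.lean` (+ work file `Cruxes/PureCubicClassGroupFBQP/Disproof.lean` for the companion crux 11544)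
- Well-posedness `classNumber_eq_of_admissible`, normal form `crux_iff_targetBits_hard`; `pureCubicClassNumberHard_false_without_PolyTime`
  (`exists_unbounded_randAlg_correct`: the time bound is the whole content), `exists_ppt_correct_at_input_two` (pointwise quantifier order FALSE, E04),
  thresholds `hardAtThreshold_mono`, `hard_of_one_lt_threshold` (c > 1 silly-true), `withoutNonCube_of_two_cubic_fields` (the non-cube clause makes X
  non-trivial; needs two cubic class numbers — `twoCubicClassNumbers` PROVED in the 11544 work file: `h(ℚ(∛2)) = 1` by Minkowski, `h(ℚ(∛7)) ≠ 1`
  by a non-principal prime of norm 2), `hard_iff_infinitely_often` / `crux_iff_infinitely_often_hard` / `crux_iff_infinitely_many_lengths`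
  (worst-case = i.o. hardness by patching, `isPolyTime_patch`), MODEL NOTE `isPolyTime_outputs_any_unary_predicate` (E07).
  For 11544 (`PureCubicClassGroupFBQP`): `not_crux_iff` (a disproof = crux #2 AND a quantum lower bound for an `FPSPACE`-type function — E05),
  `conclusionWithoutFBQP` (dropping `f ∈ FBQP` leaves a TRUE statement), `not_conclusionWithoutNonCube_holds`, `…WithoutCubeRoot_holds`,
  `cruxWithout…_iff_not_escape` (mutilated cruxes collapse to `¬ DegreeOnePrimesEscape`), `conclusion_of_canonicalF_mem` (what a prover must do).

### QA-D19 · `CubicForrelation.SignedCubicForrelationInPrBPP` (stmt-13933, OPEN support; signed `Φ ≥ 3/5` vs `≤ −3/5`, both cubic, `n` even, in `PromiseBPP'`) — `SignedCubicForrelationInPrBPP/Negative/{CrossCorrelation,GoldCube,ResidueNonempty}.lean` (+ C11)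
- `forrelation_mul_cross_eq`, `forrelation_eq_sign_cross_mul_sign`, `abs_cross_eq` (SIGN TRANSPORT along any noticeable correlation of the partner with a
  test function — the signed problem reduces to instances with the same bent half); `exists_biquadratic_perm_without_affine_component` (Gold cube `x³` on
  `𝔽₈`: biquadratic, no affine component — REFUTES "every biquadratic permutation is triangularisable up to affine equivalence", the MM-peeling decoder
  does not always start); `residue_witness_P4` (the residue of line `polar-radical-seeds` is inhabited: `P₄` has no half-dim M-subspace on either side,
  so `stub_residue` is not vacuous and `stub_safeMM` is complete only on a proper sub-promise).

### QA-D20 · `CubicForrelation.SignedCubicForrelationNotPrBPP` (stmt-13931, OPEN rank-0 support; the signed cubic problem is NOT in `PromiseBPP'`) — `SignedCubicForrelationNotPrBPP/Negative/{HalfQuadMachine,HalfQuadratic}.lean` (+ C10)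
- `signedHalfQuadProblem_mem_PromiseBPP'` (signed 2-fold Forrelation with ONE quadratic circuit, other ARBITRARY, is classical: length-squared Fourier
  sampling of the quadratic side, `N = 16` rounds, Chebyshev), `signedCubic_quadAt_mem_PromiseBPP'`, `signedDegTwoProblem_mem_PromiseBPP'` (the degree-2
  rung `XAtDegree 2` of the disprover's lattice is FALSE). Kills: hardness claims unless degree is EXACTLY 3 on BOTH sides; `terminalHard` is `P ≠ PP`-strength.

### QA-D21 · `CubicForrelation.SignedExactCubicForrelationNotPrBPP` (stmt-13932, OPEN r3; the signed EXACT slice `Φ = 1` vs `Φ = −1`, both cubic, not in `PromiseBPP'`) — `SignedExactCubicForrelationNotPrBPP/Negative/SignedExactCubicForrelationNotPrBPPFalseOfPairFinderExact.lean`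
- `SignedExactCubicForrelationNotPrBPP_false_of_PairFinderExact : PairFinderExact → ¬ crux` — NEGATIVE LEMMA MODULO the open construction
  `PairFinderExact` (an `FP` worst-case finder of a half-dimensional M-subspace of the second function on every exact cubic instance; every planted
  family tried — `n ≤ 96`, > 600 instances, four implementations — solved with 0 wrong signs, no running-time theorem); from the landed stubs of line
  `dual-pingpong-frame` (`stub_signReadout`, `stub_plumbing`); `pairFinderExact_of_complete` (completeness of the landed `findV2` + r5 ⇒ the finder),
  `SignedExactCubicForrelationNotPrBPP_false_of_complete`. The crux stands or falls with r5 (D09) and the finder's completeness: a proof of r5 plus a uniform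
  running-time bound for the ping-pong finder refutes X and breaks the route's thesis again (repair menu in the route header).

### QA-D22 · `CubicForrelation.SignedExactSliceIsLift` (stmt-14830, PROVED, C05) — `SignedExactSliceIsLift/Negative/{LandedFamilyUngapped,DegreeBlindUngapped,TopGapTightness}.lean`
- `exists_wf_cubic_code_ungapped` (acceptance EXACTLY 37/64 on `(2,2,x₀∧x₁,x₀∧¬x₁)`), `landedFamily_not_bqp_decider` (the landed signed family decides NO
  language: amplification is load-bearing), `not_noSide_le_third` (the `K = 1` shortcut is false), `degreeBlind_andPower_ungapped` (a family reading
  `C.eval` directly is ungapped at every AND-power: degree PROJECTION is load-bearing; `exists_allRead_code_value` with `Φ = 1 − 2/4^t`),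
  `exists_wf_code_of_pair`/`stubV_p0_ge_of_pair` (every near-exact cubic pair lower-bounds the top gap), `forrelation_kasamiTokura = 3/4`,
  `stubV_p0_ge_kasamiTokura`, `andPower_copies_ge_52`.

### QA-D23 · `WhiteBoxWalk.WbwObfuscatedGluedTrees` (stmt-2340, OPEN informal crux: iO + puncturable PRF + injective OWF ⇒ clause (C) of `WbwThesis` for the obfuscated glued-trees generator) — `WbwObfuscatedGluedTrees/Negative/{LoadBearing,GrowthClosure,GrowthSequences,Altimeter,StructuredCycle,TypedTraps,KeyedIndistinguishability,CoinPadding,CoinLengthAdvice,SplitMutation}.lean`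
- `not_cruxShape_imp` (no UNCONDITIONAL refutation can exist: it would yield sub-exp iO + PRF + injective OWF), `cruxShape_of_no_subexpIO/_no_injectiveOWF`
  (vacuity modes); information that MUST stay hidden or a classical walker wins: `degree_eq_two_iff` (EXIT is publicly verifiable), `roleWalk_eq_exit`
  (role-ordered names are broken), `dec_forge`/`forge_ne_name`/`canonical_rejects_forge` (integrity-free decoders admit aliases), `eq_parentV_of_adj_of_depth_lt`
  (depth leak), `altimeter`, `not_onSquare_of_depth_add_two_le` + `onSquare_σ₀_iff`/`σ₀_altimeter`/`σ₀_leaf_orientation` (the STRUCTURED cycle `σ₀ = (id,id)`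
  is classically broken: pseudorandomness of the cycle is load-bearing, not just secrecy); BPR punctured-programming template: `sInter_isGrowthClosed_eq_oneRound`,
  `killed_iff_mem_oneRound`, `exit_mem_oneRound_iff`/`killed_exit_iff` (un-naming EXIT by growth steps forces a plant at EXIT or BOTH its children — no
  cascade on an undirected neighbour circuit, contrast `line_cascade`); `keyed_family`/`keyed_family_subexp` (the quantifier-order form hybrid steps consume);
  typed traps `clauseC_false_of_ans_const_frequently`, `…_nil_frequently`, `clauseC_false_of_ans_lengthIndexed` (coin-length advice channel, E07),
  `coinClause_unsatisfiable_of_coinLen_pos`, `exists_subexpIO_pointwise_coinClause_false`, `subexpIOExist_iff_pos_coins` (w.l.o.g. an iO tosses a coin;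
  the superseded pointwise coin clause of `stub_bestPossibleStep`/`stub_obfuscationMonotone` was VACUOUS), `kappa_le_of_pointwise_coinClause`,
  `uniformProb_prefix_le`; split lemma: `splitLemma_false_without_length`, `…_without_valid`, `not_clauseC_self`.

### QA-D24 · `WhiteBoxWalk.WbwThesis` (stmt-2238, OPEN rank-0; planted unique-answer white-box advantage: `∃ gen ans, gen ∈ FP ∧ |ans| = p(|gen|) ∧ (Q) ∧ (C)`) — `WbwThesis/Negative/{LoadBearing,GuessingBound,Diagonal}.lean`
- `wbwThesis_iff`, `ans_eq_of_gen_eq` ((Q) makes answers a function of instances), `wbwThesis_false_without_PPT` (table adversary: (C) is purely computational),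
  `clauseCwc_of_clauseC` ((C) is STRONGER than the glue uses — planner: the target could be weakened to worst-case), `dlog_clauseQ_shape` ((Q) is
  unconditionally available for DLOG instances), `answerLength_decay_of_clauseC`, `clauseC_false_of_log_answers`, `not_wbwThesisBoundedAnswers`
  (bounded/one-bit answers kill (C): X is irreducibly a SEARCH statement), `exists_isOneWay_of_wbwThesisPlanted` (planted X ⇒ OWF exist: A06/A07
  strength, no unconditional proof; "the instance hides the seed" is a checkable necessary condition on the generator), `wbwThesisWithoutQ_holds`
  (X with (Q) dropped is a THEOREM by diagonalisation: clause (Q) carries ALL the content).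

### QA-D25 · `WhiteBoxWalk.WbwVerifiableLineNoSpeedup` (stmt-2239, PROVED, C07) — `WbwVerifiableLineNoSpeedup/Negative/{LoadBearing,Tightness,GroverTight,Padding,QueryReindex,PermInstances,PermClosure,AdversaryDatum,AdversaryLine,AdversaryCounts,AdversaryBound,WeightedAdversary,WeightedAdversaryBound,GoodSetCardTight}.lean`
- `svlAdversarySmallT`, `weightedAdversaryBound_holds` (Ambainis Thm 6 for `QQueryAlg`, promise version), `quantumQueryComplexityOn_le_of_reindex`,
  `quantumQueryComplexityOn_svl_pad`; load-bearing `wbwVerifiableLineNoSpeedup_false_without_Tpos`, `…_without_Tbound`; tightness `quantumQueryComplexityOn_svl_le_sqrt`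
  (`≤ 76√(2^{m−1})`, Grover), `svlQ_le_mul` (`≤ m·T`, walk), `one_le_svlQ`, `pointwise_bound`, `admissible_const_le_one`, `not_walkBranchOnly`,
  `not_groverBranchOnly`; per-cut good-set count of line `cycle-surgery-adversary`: `goodSetCard_tight` (attained at `m = 4, T = 7`), `not_goodSetCard_succ`,
  `goodSetCard_false_of_three_le` (`4 ≤ m` load-bearing), `goodSetCard_false_without_Tbound`.

### QA-D26 · [g2] `CompactnessLift.CompactnessPrinciple` (stmt-15270, PROVED as typed — C13) — `CompactnessPrinciple/Negative/{StubFuelledClockFalse,SliceZeroEmpty,StubFuelledClockGuard,ExponentTight}.lean` (+ work file `Cruxes/CompactnessPrinciple/Disproof.lean`, cycle 1, 2026-08-17)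
- `SliceZeroEmpty`: `bp_DTIME_pow_zero_eq_empty : bp (DTIME fun n => n ^ 0) = ∅` — engine: the INPUT-CONSUMPTION bound `length_input_le_of_outputsWithin`
  (`|l| ≤ |l'| + Q·m`, `Q = machinePopBound`; twin of the tree's output bound `OutputsWithin.length_le`), `iterate_bind_ge`, `timeClass_const_eq_empty`,
  `DTIME_eq_empty_of_le`, `DTIME_pow_zero_eq_empty`, `bp_empty`, `bpTime_empty`; readings `subset_bp_DTIME_pow_zero_iff`, `exists_not_mem_bp_DTIME_pow_zero_iff`,
  `exponent_pos_of_subset_bp_DTIME_pow`. `ExponentTight`: `quadQ_nonempty` / `BQTime_sq_nonempty` — the gate-free family `⟨0 ancillas, no gates⟩` decides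
  `{x : |x| ≥ 1 ∧ x₀ = 1}` with an `O(n²)`-time description writer (`idFamily_timeUniform`, `exists_linearTime_pairSep`, `acceptProb_nil_zero_or_one`,
  `acceptProbOn_idFamily_zero_or_one`): the first kernel-checked inhabitant of a fixed-time uniform quantum class of the tree; hence
  `not_quadQ_subset_bp_DTIME_pow_zero` (the strengthening `c = 0` of the crux's conclusion is FALSE outright), `exponent_pos` (every witness has `c ≥ 1`; tight,
  `c = 1` attained under `BQP ⊆ BPP`), `languageLadder_rung_zero`. Work file (cite only with the landed twins): `bp_DTIME_pow_eq_ite : H1 → bp (DTIME (·^c)) = if c = 0 then ∅ else BPP`,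
  `languageLadder_iff_of_H1 : H1 → (LanguageLadder ↔ ¬ QuadQ ⊆ BPP)`, irrefutability of the INTENDED principle: `not_cp'_imp_collapse : ¬ CP′ → BQP ⊆ BPP`,
  `not_cp'_imp_not_summit`, `not_compactnessPrinciple_imp_not_summit`, `cp'_iff_glue' : CP′ ↔ (Ladder′ → QuantumAdvantage)`; the only negative avenue is
  relativized — `OracleDichotomyPos` (item 15277: an oracle world with `BQP^A ⊆ BPP^A` and unbounded classical overhead over `BQTime^A(n²)`; open, needs an
  oracle CONSTRUCTION, FFKL base + levelled Forrelation traps).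
- STUB KILLS on line `coin-padding-slices` (registered, not picked): `stub_fuelledClock : ∀ p B, ∃ a, TimeComputable id id (clockFn p B) (a·n + a)` is FALSE
  (`StubFuelledClockFalse.stub_fuelledClock_false`, p154598; witness `(p, B) = (X², 0)`: with budget `B = 0` the fuel guard always passes and the output is quadratic
  in `|w|`, while `a|w| + a` steps push `≤ D·(a|w| + a)` symbols — `not_timeComputable_clock_sq_zero`); `StubFuelledClockGuard.clock_not_linearTime` (general
  criterion: `p ∉ O(B + X)` kills linear time) and `stub_fuelledClock_false_of_guard` (for EVERY guard `B` some `p` breaks it ⇒ the repair must RELATE `p` to `B`: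
  `∀ n, p n ≤ B n`, under which `length_clock_le_of_forall_eval_le : |clockFn p B w| ≤ 2|w| + 1`). Class: stub-misstated; the picked line
  `universal-clock-padding` closed the crux (C13).
- Kills: the `c = 0` strengthening; slack-free clocks; guard-only repairs of fuelled clocks. Must use: `c ≥ 1`; a domination relation between clock and budget.

### QA-D27 · [g2] `CompactnessLift.LanguageLadder` (stmt-15271, OPEN but kind `aside` — summit-strength as typed, C13; re-typed as `LanguageLadderR` 18127) — `LanguageLadder/Negative/{SlackArtefact,RungStructure}.lean` (+ work files `Cruxes/LanguageLadder/{Disproof,LeadVerdict,RedirectCensus,LadderCliffs,Census,CensusG1,LanguageLadderSplit}.lean`)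
- `SlackArtefact` (what is load-bearing, and only through `n = 0`): a zero-step `TM2` run is impossible (tree `Literature.Computability.Complexity.not_outputsWithin_zero`),
  so `not_timeComputable_of_apply_eq_zero`, `BQTimeUniform_eq_empty_of_apply_zero` (every exact quantum class with `t 0 = 0` is EMPTY), `timeClass_eq_empty_of_apply_zero`
  (same classically: the `+ c` of `DTIME t = ⋃ c, TimeClass (c·t + c)` is load-bearing the same way), `iUnion_BQTimeUniform_mul_sq_eq_empty`,
  `languageLadder_false_without_slack`, `languageLadderR_false_without_slack` — the slack-free ladders are FALSE because their witness class is empty: an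
  artefact boundary, not evidence (any restatement keeps an additive constant in the description budget, or clocks from `n ≥ 1`).
- `RungStructure` (the quantifier structure): `not_languageLadder_iff` (a kill is literally ONE exponent `c` with `BQTime (·^2) ⊆ bp (DTIME (·^c))`, i.e. the
  dequantization `BQTime(n²) ⊆ BPP` — nothing cheaper), `languageLadder_iff_forall_pos` (rung 0 is implied by every other rung), `bp_DTIME_pow_mono` / `rung_anti`
  (rungs monotone from `c = 1` on), `languageLadder_iff_tail`, `languageLadder_iff_frequently`, `not_languageLadder_iff_eventually` (a kill at one exponent is a kill
  at every larger one), `exists_forall_ge_bp_DTIME_pow_eq_BPP` (all but finitely many rung classes ARE `BPP`): no low rung to pick off, no rung split that weakens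
  the statement. Lead verdict file: `ladderSwap_of_languageLadder` (the typed crux already yields ONE `BQTime(n²)` language outside EVERY `BPTime(n^k)`,
  `bp_DTIME_id_subset_bp_DTIME_pow_one`, `BPTime_pow_subset_bp_DTIME_id`), `languageLadder_iff_tail_one`, `summit_of_languageLadder_of_bppCovered`.
- For the REPAIRED crux `LanguageLadderR` (work files; cite as such until landed): `not_languageLadderR_iff` (`¬ LL′ ↔ ∃ c, BQTime (·^2) ⊆ BPTime (·^c)`, a
  UNIFORM-exponent dequantization — with quadratic padding `¬S`), `languageLadderR_of_languageLadder`, `quadQ_subset_BPP_of_not_languageLadderR`; cliff lemmas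
  (`LadderCliffs.lean`, forward generator `ladder-down`): `mRung_BQTime_two_iff_languageLadderR`, `languageLadderR_imp_w`, `w_iff_hier_or_summit : MRung BQP ↔ Hier ∨ QuantumAdvantage`
  (the first rung below the crux on the machine-class axis is "a `BPTIME` hierarchy OR the summit"), `cRung_imp`, `summit_iff_not_subset`. Reading: hypothesis-type,
  refuters first; provable content = rSETH-conditional low rungs (`SethLanguageRung` 15280).
- Kills: slack-free / `n = 0`-clocked variants; rung-splitting plans; any refutation plan short of uniform dequantization of `BQTime(n²)`.

### QA-D28 · [g2] Stub-level refutations and hypothesis autopsies landed flat under `Theorems/` (registered stubs of live LINES found false or degenerate — the cruxes stand; MobiusLadder cruxes 1389 / 1391 / 1392 / 1393)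
- `DigitPolyUniformity` 1392, line `Sketch` c6 — `Theorems/MobiusLadderDigitPolyUniformityRigidityWideFalse.lean`: the WIDE ×p-rigidity hypothesis `RigidityWide`
  (from which `…RigidityGlueWide`, p138984, derived the weak `AC⁰[⊕]` target W) is FALSE — bottom-end 2-adic chirps: near-solutions of `F(pm) = −F(m)` (`p ≤ C`)
  living in the LOW digits (`u ≡ ±5^{ind u} (mod 2^k)`, the 2-adic analogue of the Benford chirps `sgn cos(2πk log₂ m)`) defeat every test family whose bottom depth
  `C'` is fixed before the polynomial is chosen. Must use: a bottom depth growing with the degree budget (`…RigidityGlueFlex`, `…WeakGlueRange` are the reshaped glue).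
- `QuadraticDigitPhases` 1391, line `Sketch` v30 — `Theorems/MobiusLadderQuadraticDigitPhasesStubUwcOpCoreFalse.lean` (+ `…Lemmas`): the v24–v29 core `stub_uwcOpCore`
  is REFUTED (registered negated as `stub_uwcOpCoreFalse`); witness `(p, q) = (3, 5)`, `R₀ = 3`, `δ = 1/2`, the interleaved product pattern `(Σ_{BF} x)(Σ_{KF} x)`
  (every digit cut of rank `≤ 2 < R₀`, sequential far pairs of span `G > s`, dependent births), mass `Σ|μ_N| = 2^N > 2^N/2`. Positive counterpart landed:
  `…StubNoExactTwistedCycle.lean` (+ `…NoExactA/B`): NO exact twisted cycle for ALL pairs of distinct odd primes (`m₀ = pq + 2`) ⇒ word decay of the pair-carry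
  transfer words (with `stub_uwcOfNoExact`, `stub_stationary`, `stub_wordDecayOfUWC`) — the root of the HIGH branch of the line.
- `LiouvilleOrthogonalTC0` 1393, line `Sketch` — `Theorems/MobiusLadderLiouvilleOrthogonalTC0HypZero.lean`: `not_localPieceHardness_zero` (at the degenerate scale
  exponent `A = 0` the hypothesis `LocalPieceHardness δ₀ κ Λ₀ A` is FALSE for every `δ₀ > 0`: Lean's `n / 0 = 0`, `n ^ (−0) = 1` collapse the side conditions, the
  one-element piece `{1}` qualifies and the constant circuit `false` predicts `[λ(1) = −1]` exactly), `not_exists_localPieceHardness_all` (the originally registered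
  `∀ A` stub is REFUTED and the landed `stub_transfer` with hypothesis `∀ A` is VACUOUS; the repaired stub quantifies `A ≥ 1`), `localPieceHardness_anti`;
  `…HypMono.lean`: monotone in `δ₀`, `κ`, `Λ₀` (`exists_localPieceHardness_iff_eventually`; constant predictors force `Λ₀ > 3` for `κ ≤ 1` and
  `δ₀ < log(1+κ)/(1+log(1+κ))`, a `TC⁰` primality test on rough numbers would force `κ ≥ 2`). Pattern E02.
- `LiouvilleNotPPoly` 1389 — KILL SHAPES typed by the lines themselves (conditional theorems, hypotheses explicit): `Theorems/MobiusLadderLiouvilleNotPPolyStubTwinsRefute.lean`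
  (eventual polynomial-bit Liouville TWINS — `d_n` with `|d_n| ≤ 2^{n^k}` and `(d_n | p) = −1` at every odd prime `p ≤ 2^n` —, plus Jacobi symbol and the 2-adic split
  in `FP`, put `L_λ ∈ P/poly` with advice the code of `d_n`: the twin-exclusion line must prove NO such twins exist — `…TwinDebt`, `…TwinFreeGRH`, `…TwinKernel`,
  `…StubTwinFreeSublinear`, `…StubTwinsInP`), `Theorems/MobiusLadderLiouvilleNotPPolySubexpTightness.lean` (a RARE-ERROR `P/poly` family — wrong on `≤ 2^{ℓ−ℓ^ε}/16`
  words of every large length — already puts `L_λ ∈ P/poly` via the multiplicative one-time pad `padOracle` (`liouville_eq_neg_one_iff_mul_ne`; `stub_padOracle`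
  hypothesis): worst-case and `2^{−ℓ^ε}`-rare-error hardness of `λ` COINCIDE, so "mild average-case hardness of λ" is NOT a weaker target),
  `…SelfAmplification`, `…MildAvgHardOfApex`, `…FactoringAvgHard`, `…HardcoreInstances`, `…Dominance` (the apex dominates factoring-type average-case hardness).
  With C14 (`L_λ ∈ NP ∩ coNP`) the apex is boxed between "a `P ≠ NP` proof to establish" and "refuted by ANY rare-error polynomial-size family".
- Dead lines recorded as markdown (not theorems; `ledger crux cat <item> Lines/<file>`): `LiouvilleNotPPoly/Lines/{SketchDead,SketchIdeator2Dead,SketchIdeator4Dead}.md`,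
  `IqThreeNotPPoly/Lines/{Sketch-dead,SketchIdeator3-dead}.md`, `PureCubicClassNumberHard/Lines/{Sketch-dead,Ideator1Sketch-dead}.md`,
  `AvgFaceBeyondPrior/Lines/mirror-unit-signature-dead.md`, `LanguageLadder/Lines/Ideator2Notes-dead.md`.

---------------------------------------------------------------------------------------------------------------------------------

## Part E — Cross-cutting failure patterns (what the refutations above have in common; run this list over every new crux, cf. the crux typing checklist)

- **E01 · Hand-picked constants invite sporadic witnesses.** `CubicStability` (3/5, 1/4) fell to `P₄` (B01); `NearExactIsExact`'s conjectured `θ = 7/8`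
  fell to a 15/16 pair (D16); `GaussRankTwoCopies`' 3 cannot be 4 (D12); `stub_goodSetCard` is attained exactly (D25). State `∃ θ < 1` / the weakest constant
  the assembly consumes; expect direct-sum / tensor / block constructions (`exists_power_beyond_log_defect`, `Φ` multiplicative over blocks). [g2] `7/8` is ATTAINED by a
  non-exact cubic pair at `n = 10` and `13/16` at `n = 8` (D16 `ValueWitnesses`); the isolating threshold's small-`n` profile is certified (`nearExact78_le_six`).
- **E02 · Degenerate parameters inside "for all".** Zero polynomial in a Frobenian datum (B03); `p = 2` semiprimes (B05); `M = ⊤` (A18); `m ≤ 24` periods,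
  `d < 16` (D13/D14); `t = 0, 1` copies (D17); `n` odd (D05); `T = 0`, `T ≥ 2^{m−1}` (D25); `k` odd for idle-wire guards (D04). Add the side condition or
  quantify it away explicitly. [g2] `z = 0` in a cube-class witness clause (B06); scale exponent `A = 0` (D28 `not_localPieceHardness_zero`); budget polynomial
  `B = 0` in a fuel guard (D26 `stub_fuelledClock_false`); exponent `c = 0` / clock `t 0 = 0` (D26/D27); `ε₁ = 0` noise-exempt wires (A14).
- **E03 · Junk values and empty classes.** `acceptProb = 0` on the empty register (`hadFamily_acceptProbOn_nil`, `nil_not_mem`), `SIZE s = ∅` when `s 0 = 0`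
  (`SIZE_eq_empty_of_apply_zero`), `Fin (n+1)` annihilators make the dictionary empty (`no_overcomplete_annihilators`), empty promise sets (`svlQ_eq_zero_of_two_pow_lt`).
  [g2] `bp (DTIME n^0) = ∅`, `TimeClass t = ∅` and `BQTimeUniform t = ∅` whenever `t 0 = 0` (D26/D27: sublinear classes are empty, a zero-step run is impossible) —
  the additive slack of every time / description budget is load-bearing exactly at `n = 0`; and conversely `BQTime (·^2) ≠ ∅` (`quadQ_nonempty`) is now a theorem.
- **E04 · Quantifier order.** `∀ x ∃ A` hardness is false by constant algorithms (`exists_ppt_correct_at_input_two`); `∃ t ∀ c` vs `∀ c ∃ t` (`not_uniformT`);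
  the quantifier-swapped SVL bound is trivially true (`pointwise_bound`); keyed iO families need the `∀ (C₀,C₁)`-inside form (`keyed_family`).
- **E05 · "A kill (or a proof) is a class separation."** Refuting `DeqThesis` = the summit (D07); refuting `PlLift` = the summit (C06); refuting `IqThreeMemBQP`
  ⇒ `BQP ≠ PSPACE` (D13); proving `IqThreeNotPPoly` ⇒ `PSPACE ⊄ P/poly` (D15); `GaussRankPolyImpliesPPoly` refuted ⇒ `P ≠ PSPACE` (D11); `terminalHard` ⇒ `P ≠ PP`
  (C10); `AvgFaceBeyondPrior` ⇒ `IQ3 ∉ BPP` (D02); `PureCubicClassGroupFBQP` refuted ⇒ quantum lower bound for an FPSPACE function (D18). Such items are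
  hypothesis-type: staff membership, reductions and mutations, not the separation (A03). [g2] `LanguageLadder` as typed = the summit in the quadratic window and
  `¬ CP′ ⊢ BQP ⊆ BPP` (C13/D26/D27); `LiouvilleNotPPoly` ⇒ `P ≠ NP` (`pneNP_of_liouvilleNotPPoly`) and `SQF ∉ P/poly` ⇒ `NP ⊄ P/poly`, `FACT ∉ P/poly` (C14);
  `LanguageLadderR → (Hier ∨ S)` (D27); `ThirdNotBPPR`, `SectorHardness`, `PriorBand`-type targets are `AWPP ⊄ BPP`-hard (A03 [g2]).
- **E06 · Encodings that under-determine.** Bare `encodeNat` prefixes are ambiguous (`encodeNat_one_isPrefix_encodeNat_three`: the Hallgren fact as typed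
  does not pin `3 ∣ h`; use `boolPair` self-delimitation, D13); `decodeNat` non-injective (harmless when the clause depends on `(decodeNat x, |x|)`, D18);
  instance codes write `n` in binary so deciders cannot touch all wires (idle-wire guard, D04).
- **E07 · Model features of `RandAlg.IsPolyTime` / `IsPPT` / `SampP`.** The coin budget `coinLen` is only polynomially BOUNDED, not computable: PPT = PPT with
  `O(log n)` bits of length-indexed advice (`isPolyTime_outputs_any_unary_predicate`, `coinCounter_isPPT`, `clauseC_false_of_ans_lengthIndexed`); hence
  `SampP` is uncountable, `sampP_ne_sampBQP` is a theorem, `SampPRel_empty` is false (A17), `aaronsonChen2017_thm81` is vacuous (A07). Type uniform classes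
  (`UniformSampP`) when uniformity matters; never let an answer be a function of the length alone. [g2] The same free-padding feature one level down: the operator `bp`
  draws coins of ANY polynomial length and clocks the inner machine on the padded pair — E09.
- **E08 · What must be USED (load-bearing hypotheses found by mutation).** Uniformity and `ε < 1/2` for any `BQP ⊆ BPP` proof (D07); all three layer structures
  for composite frames (D03); Gaussianity + independence + annihilation + the count for Gaussian-rank bounds (D10/D17); cubicity of BOTH `g` and its dual for
  MM-structure stubs (D09); `M ≠ ⊤` (A18); centring, size, basis, pins and the fundamental filter for AC⁰ rungs (D01); `Pins` for digit rungs (D08); `1 ≤ T`,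
  `T+1 ≤ 2^{m−1}`, `4 ≤ m` (D25); conditioning on fundamental discriminants (D02); `IsPolyTime` everywhere (D02, D18, D24); clause (Q) (D24). [g2] The additive slack `+C` / `+c` of description
  and time budgets (D27); a clock–budget domination `p ≤ B` (D26); `z ≠ 0` (B06); `A ≥ 1` (D28); wire noise on EVERY wire, `ε₁ > 0` (A14); a bottom test depth
  growing with the degree budget (D28 `RigidityWide`).
- **E09 · [g2] Operator classes with free padding carry no exponent.** `bp (DTIME (·^c)) = BPP` for every `c ≥ 1` and `= ∅` at `c = 0` (`paddingCollapse`,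
  `exists_bp_DTIME_pow_eq_BPP`, `bp_DTIME_pow_eq_ite`; likewise `BPTime (·^k) ⊆ bp (DTIME id)` for every `k` — work file `BPTime_pow_subset_bp_DTIME_id`): a "fixed classical exponent"
  typed through `bp ∘ DTIME` is decorative — the filed `CompactnessPrinciple` became a triviality and the filed `LanguageLadder` the summit (C13), costing a route
  its two cruxes. Type fine-grained probabilistic classes with honest `BPTime t` (coins inside the clock; Arora–Barak Def 7.2–7.3) and run the TWO-VALUE TEST on every
  exponent-indexed family before filing (is slice `0` empty? is slice `1` already everything?); the same test applies to advice-, coin- and promise-indexed families (E07).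

---------------------------------------------------------------------------------------------------------------------------------

## Part F — Pointers

- **Uncatalogued barrier / negative notes** written by ideators and disprovers (markdown under `Summits/QuantumAdvantage/QuantumAdvantage/Cruxes/<Crux>/`;
  harvest candidates for barrier-audit refuters; read with `ledger crux cat <item> <file>`): `AvgFaceBeyondPrior/BarrierNotes-r1-k3.md`,
  `DegreeOnePrimesEscape/NegativeNotes-dedekind-s3-collision.md`, `…/NegativeNotes-subgroup-orthogonality-escape.md`, `DeqThesis/BarrierNotes-r1-k2.md`,
  `DigitPolyUniformity/AllPairsTransferNegativeNote.md`, `ExactPairsMaioranaMcFarland/NegativeNotes-{stub_defect_vanishing,stub_local_to_global,stub_local_to_global-m5-theorem,stubs_bridge_flats_dillon}.md`,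
  `IqThreeNotBPP/BarrierNotes-r1-k1.md`, `…-k2.md`, `IqThreeNotPPoly/BarrierNotes-r1-k3.md`, `LiouvilleNotPPoly/BarrierNotes-r1-k2.md`, `…/NegativeNotes-r1-k1.md`,
  `NegApproxGaussRankSuperpoly/FlatteningWall.md`, `PlLift/Obstructions.md`, `SignedCubicForrelationInPrBPP/Negative-iterated-shears.md`,
  `SignedExactCubicForrelationNotPrBPP/Negative-two-sided-mm-peel.md`, `…/BIISO.md`, `WbwObfuscatedGluedTrees/{Ideator3-BarrierNotes,NegativeNote-Admissible-coin-discipline,NegativeNote-stub_bestPossibleStep,NegativeNotes-T8-computable-coins,NegativeNotes-reshape-recheck,NegativeNotes-stub_bestPossibleStep,NegativeNotes-stub_obfuscationMonotone,NegativeNotes-stub_split}.md`,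
  `WbwThesis/Ideator2-BarrierNotes.md`, `CubicStability/{Counterexample-P4,REPAIR-MEMO}.md`, `CubicForrelationInPrBPP/DREFUTE-pauli-ct-overlap.md`,
  `PureCubicClassGroupFBQP/DREFUTE-arakelov-giant-step-cycle.md`, `GaussRankTwoCopies/DrefuteLagrangianTripleRigidity.md`,
  `WbwVerifiableLineNoSpeedup/Drefute{,G2}CycleSurgeryAdversary.md`; [g2] `LanguageLadder/{BarrierNotes-r1-k1,Ideator2-NegativeNotes,Ideator4Notes-r2,Ideator5-OracleDichotomyPositive,PROBES-RESULTS,PROBES-SOURCES,LADDER-LanguageLadder}.md`,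
  `CompactnessPrinciple/NEGATIVE-NOTES-ideator2.md`, `LiouvilleNotPPoly/{BarrierNotes-r2-k4,NegativeNotes-r2-k5}.md`, `SignedExactCubicForrelationNotPrBPP/Census-biquadratic-m5.md`.
- **[g2] Strategy censuses** (`Cruxes/<Crux>/STRATEGY-CENSUS.md`: crux-strategist `no-strategy-short-of-summit` records, each with concrete Transfer / Strengthen /
  Decomposition / Negation attempts and the reason they give no leverage — negative knowledge about WHICH reformulations of a crux have no teeth; read before re-ideating):
  AAConj, ApcThesis, ArgLeg, AvgFaceBeyondPrior (+ `CensusSketch.lean`), CommutingWitness, CompactnessPrinciple (+ `CensusSketch.lean`), DeqStabrankPolyUniform (+ `CensusSketch.lean`),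
  GaussPowerFBQP, GraphHSPHard (+ `DecompositionCensus.lean`), HiddenSpreadWitness, IdealLegOfEscape, IqThreeMemBQP, LanguageLadder (+ `REDIRECT-CENSUS-r1.md`,
  `RedirectCensus.lean`, `Census.lean`, `CensusG1.lean`), LiouvilleNotPPoly, NearExactIsExact, OneThirdFP, PlLift, PromiseTransfer, PureCubicClassNumberHard, RefThesis,
  SignedExactCubicForrelationNotPrBPP, Target (DyadicGap/ParityFrontier; + `STRATEGY-CENSUS-DyadicGap.md`, `StrategyCensus.lean`), TorsorHard, TwoSquaresMemBQP,
  XorCharFlat (+ `RedirectCensus.lean`), YbTarget (+ `CensusSketch.lean`).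
- **Standing disprover work files** (overwritten each generation; cite only what is also landed): `Cruxes/<Crux>/Disproof.lean` for AcZeroRung, AvgFaceBeyondPrior,
  CompositeFrameBound, CubicForrelationInPrBPP, DegreeOnePrimesEscape, DeqThesis, DigitRung, ExactPairsMaioranaMcFarland, FlatteningBoundRobust,
  GaussRankPolyImpliesPPoly, GaussRankTwoCopies, IqThreeMemBQP, IqThreeNotBPP, IqThreeNotPPoly, [g2] CompactnessPrinciple, LanguageLadder, NearExactIsExact, NegApproxGaussRankSuperpoly, PlLift,
  PureCubicClassGroupFBQP, PureCubicClassNumberHard, SignedCubicForrelationInPrBPP, SignedCubicForrelationNotPrBPP, SignedExactCubicForrelationNotPrBPP,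
  SignedExactSliceIsLift, WbwObfuscatedGluedTrees, WbwThesis, WbwVerifiableLineNoSpeedup (+ `CubicStability/Refutation.lean`).
- **Adjacent Literature no-gos the entries lean on** (tree theorems / facts, not catalogued separately): `Literature.Computability.QuantumComplexity.{exists_oracle_BQPRel_subset_BPPRel, exists_oracle_BQPRel_not_subset_BPPRel, exists_oracle_BQPRel_not_subset_PHRel, bqp_bpp_relativization_barrier}`,
  `Literature.Computability.Complexity.{aaronsonWigderson2009_bqp_subset_bpp_collapse, aaronsonWigderson2009_bqp_not_subset_bpp, not_isAlgebrizingInclusion_bqp_bpp, natural_proofs_barrier, detQueryComplexity_le_pow_four}`,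
  `Literature.Computability.Cryptography.{sampP_ne_sampBQP, not_countable_sampP}`, `CubicDequant.cubicKForrelationProblem_two_mem_PromiseBPP'`,
  `yamakawa_zhandry`, `raz_tal_forrelation`, `simon_upper/simon_lower`, `BQP_subset_PP`, `FACT_mem_BQP_holds`, `countable_BPP`, `BPP_subset_BQP_holds`, `BQPWith_eq_BQP_holds`.
- **Provenance.** Every statement above was read from the tree files named (gen 1: 2026-08-16; gen 2: 2026-08-17 — all `[g2]` material read from
  `Literature/Barriers/QuantumAdvantage/{QuantumNaturalProofs,CryptoOWFCollapseWorld,NaturalProofsScope,SupremacyTheoremsNonRelativizingFixedProblem,PPolyOraclesThm76Frontier,PPolyOraclesDischarge,Relativization,SeparationPrerequisites,TotalFunctionSpeedupLimit,NoiseThresholdUpperBounds}.lean`,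
  `Theorems/RegulatorThirdThirdNotBPPRefutation.lean`, `Theorems/{CompactnessPrinciple,LanguageLadder,NearExactIsExact,AcZeroRung}/Negative/*.lean`, `Cruxes/{CompactnessPrinciple,LanguageLadder}/*.lean`,
  and the flat `Theorems/{CompactnessLift*,ArithStatLadderIqThreeNotPPoly*,MobiusLadder*,PhiHidingThree*,LinnikCubicClassGroupsPureCubicClassNumberHardHonda25}.lean` files named in C13–C15 / D28;
  decl names after the 2026-08-14 namespace alignment: summit decls `Summit.QuantumAdvantage.QuantumAdvantage.…`, Literature decls by directory). Item status and kinds from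
  `ledger workitem get route-QuantumAdvantage-<Name> --json` (structure) for all 42 non-closed routes and from `ledger negatives --problem QuantumAdvantage` (6). The
  "threatens" columns are the cataloguer's technique-class matching against the 39 open + 3 draft routes and are advisory; route and crux owners decide.

-/

namespace Literature.Barriers.QuantumAdvantage

/-- **Part A of the catalogue, conjoined and checked.** Every catalogued `Literature/Barriers/QuantumAdvantage`
barrier fact whose discharge lives inside `Literature` holds: relativization (Bernstein–Vazirani 1997 §8 with
Baker–Gill–Solovay), algebrization (Aaronson–Wigderson 2009), the separation prerequisites (Bernstein–Vazirani 1997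
§1), the natural-proofs entry (Razborov–Rudich 1997 Thm 4.1), the random-oracle method (Fortnow–Rogers 1999 Thm 4.4;
Aaronson–Ambainis 2014 Thm 7(iii)), the non-relativizing-supremacy entry (Fortnow–Rogers 1999 Cor 3.7/Thm 4.2;
Aaronson–Chen 2017 Cor 5.2), the `P/poly`-oracle entry (Aaronson–Chen 2017 Thms 7.6/8.1), the promise-lift oracle
(this tree), Beals et al. 2001 Thm 5.4, Jozsa–Linden 2003 §3, Markov–Shi 2008 Cor 1.5 (both typings), Prop 5.1 and
Thm 4.6, lattice rigidity of the Toffoli+Hadamard group, Bremner–Montanaro–Shepherd 2017 Thm 4 and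
Kempe–Regev–Unger–de Wolf Thm 1; generation 2 adds the quantum natural proofs barrier (Razborov–Rudich Thm 4.1 with a
`BQP` test; entry A19), the narrowed natural-proofs entry (A04 audit) and the exact-reach form of relativization (A01 audit).
Composition of the tree's `*_holds` theorems; the six `NoFreeFrame*` facts are
discharged Summits-side (`Literature` cannot import `Summits`) and the LinearXEB entry is the theorem
`linearXEB_not_certifying`, so neither appears in the conjunction. [folklore] -/
theorem catalogue_partA_established :
    Relativization ∧ Algebrization ∧ SeparationPrerequisites ∧ NaturalProofs ∧ RandomOracleMethod ∧
      SupremacyTheoremsNonRelativizing ∧ PPolyOracles ∧ PromiseLiftRelativization ∧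
      TotalFunctionSpeedupLimit ∧ jozsaLinden2003_pblocked ∧ markovShi2008_cor15 ∧
      markovShi2008_cor15_anyOrder ∧ markovShi2008_prop51 ∧ markovShi2008_thm46 ∧
      latticeRigidity_finiteImage ∧ bremnerMontanaroShepherd2017_thm4 ∧ NoiseThresholdUpperBounds ∧
      QuantumNaturalProofs ∧ NaturalProofsNarrow ∧ BQPRelativizationNarrow :=
  ⟨Relativization_holds, Algebrization_holds, SeparationPrerequisites_holds, NaturalProofs_holds,
    RandomOracleMethod_holds, SupremacyTheoremsNonRelativizing_holds, PPolyOracles_holds,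
    PromiseLiftRelativization.holds, TotalFunctionSpeedupLimit_holds, jozsaLinden2003_pblocked_holds,
    markovShi2008_cor15_holds, markovShi2008_cor15_anyOrder_holds, markovShi2008_prop51_holds,
    markovShi2008_thm46_holds, latticeRigidity_finiteImage_holds, bremnerMontanaroShepherd2017_thm4_holds,
    NoiseThresholdUpperBounds_holds, QuantumNaturalProofs_holds, NaturalProofsNarrow_holds, BQPRelativizationNarrow_holds⟩

-- The entries of the catalogue whose content is a negation are NOT restated here: the XEB reading (QA-A15: any
-- mode beats every distribution under linear XEB and sits at total variation `1 − q(m)`) is exactly the theorem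
-- `linearXEB_not_certifying` of `LinearXEBSpoofing.lean` (the former restatement `catalogue_xeb_reading` was
-- removed as a duplicate, dedup-02395); `noFreeFrame` is discharged Summits-side; the two tombstones are refuted
-- in their own files (`not_SampPRel_empty`, `DegreeOnePrimesEscapeWithoutProper_false`).
-- Generation 2: `CryptoOWFCollapseWorld` (QA-A20) is an open question typed with conditional consequences (no fact to
-- conjoin) and `NoiseThresholdUpperBoundsNarrow` (QA-A14 audit) is itself a theorem (a conjunction with a negation), cited by name.

end Literature.Barriers.QuantumAdvantage
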